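import Summits.QuantumFields.BalabanUV.Beta.FP.TowerKernelLawNamedB
import Summits.QuantumFields.BalabanUV.Beta.FP.StepRecursionFeedNestedComp
import Summits.QuantumFields.BalabanUV.Beta.FP.TowerHSideRowsClosing

/-!
# `BalabanUV.Beta.FP.StepRecursionFeedNestedNamedB` — road «FP» for binder row D1, ROUTE T under (β1) ∕ R-FP-72 ∕ R-FP-76: **THE END WRAPPER — ROOT M‴'s `htel`
# (`D1Tel` AT THE RECORD PAIR) FROM THE BOUNDED NAMED TOWER LAW, EVERY ROAD-SIDE OBJECT NAMED, EVERY ROW-SIDE WORD DISPLAYED; THE (S3-2) ROWS IN FAMILY FORM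
# (SPEC-46 §B′), THE FIRST-ORDER H-SIDE ROWS DISCHARGED AT THE TOTAL SLOT (SPEC-46 §C ∕ SPEC-47 §B)** (`HOME/b2b-balaban-beta-d1-p3/g34/SPEC-46.md`, `g35/SPEC-47.md`;
# an2 g59 W-4 l.66570 (3) «§B′: GO» and RULING R-D1-g59-3 l.66748 (a) «road FP may TYPE §C's H-side discharge NOW with K1 DISPLAYED-THEN-INSTANTIATED»)

WHAT.  END-Comp `StepRecursionFeedNestedComp.d1Tel_JcComp_ctr_nested_of_hessKer_laws_wStep` reads, per storey `j ≥ 1`, the kernel law `hlaw j` (+ `hF₁ htr hG`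
(T0)(T1), displayed VERBATIM).  THIS FILE supplies `hlaw j` from `TowerKernelLawNamedB.hessKer_law_tower_named` at depth `n := j − 1`, levels `lev i := n + 1 − i`
(`hlev` by `omega`; top level `j`, G chart `GcombSh Lc j`), boxes `M′ B := fine Lc (Mc B)` for ANY growing coarse sequence `Mc`, the multipliers' slot presentation
= the `Lc`-coarse sites of `fine Lc (Mc B)` (#40b's precedent), the direction labels per `(μ, ν, z)` (`σ := Fin 2`, `dv := ![dv n B (μ,0), dv n B (ν,z)]` off the
displayed direction FAMILY `dv n B : Fin 4 × Site 4 → (κ B → ℝ)`), the N chart `AN (Roots.ctr Lc) j` with an2's lattice letters (F6d-1b), the N jets = an2's `VN ∕ WN`,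
AND the three first-order H-side rows `hH₁l ∕ hH₁t ∕ a1` (by `TowerHSideRowsClosing.H1f_linear ∕ H1f_transpose ∕ a1_row`, `Y₁f := 0`, R-FP-75 (ii)) from the
DISPLAYED storey data of leaf-05's closing: blocking `Ma hMa`, Λ-coefficients `cf hcf`, weights `w`, scales `κ hκ hκn`, bottom root `ρH`, the storey DIRECTIONS
`hb n B k` LINEAR in the top one-shot source (`hbl`) with the top storey = the pinned nested column (`hbtop`), the finest KKT row (K1) (inhabited by the literal at
depth 1 BY VALUE, Engine C `prestab/k1/K1.md` 1d0cc78cc84748f0 — displayed here as a hypothesis at every depth), the `n+1` links, the PIN `hH₁f` of the total-slot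
jet, `2 ≤ Lc`, `[NeZero N]`.  EVERYTHING ELSE of the named law is DISPLAYED, lifted over `n`: the sym ∕ jet pins, `lv Xbf`, the second-order H-side (`H₂f hH₂l hH₂r hH₂t a2
Y₂f`), the namings, `W₁f W₂f Gw₁f Gw₂f`, `c n`, the N leg (J-RISK-1), the F system with its leg and letters, the G letters, and the (S3-2) rows of the three systems IN
FAMILY FORM (an2's `ExpKernelCalculus.VertexFamily ∕ VertexFamily₂`: `hVX hWX hδX`, parities and bindings `∀ n μ y (ν y')` along `dv n B (μ, y)` — exactly what the
(C1) dischargers prove).  CONCLUSION: `D1Tel Lc (JsB12CombShSym hLc N (symTablesAn1S2 3 Lc cΛ) cΛ cB) (JcComp hLc N cΛ cB (Roots.ctr Lc) Pn)` — ONE signature for the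
road's letter list.  [folklore] composition BY NAME; no `def`, no `def … : Prop`, nothing cited, 0 sorry.  Every displayed row is a HYPOTHESIS; nothing of the
dictionary ∕ Bałaban's asserted.  Generators `g35/r47/gen47.py` (family lift) + `gen48.py` (H-side) over g34's `gen46.py`.  No existing file touched.

HONEST DEPENDENCY (page 1, mandatory): continuum YM on T⁴ ⇐ BetaPertH ∧ nine spine estimates (0/9 proved); BetaPertH ⇐ (D1) ∧ (D4) ∧ CAP+tail;
G-an2-4 gates asym, D1 and NE2/3/4.  HONEST FRAMING (cell contract, verbatim): «discharging `BetaPertH` makes Bałaban's UV stability UNCONDITIONAL —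
a real constructive-QFT result; it is NOT the continuum limit and NOT the Clay problem.»  ABSOLUTE RULE (cell charter, verbatim): «No internally-minted
statement may enter as a cited fact. Every hypothesis is either kernel-proved in this package or a verbatim quotation of a PUBLISHED theorem with page
reference. The manuscript(s) under audit are NOT citable for their own disputed steps — they are the thing under adjudication; programme-internal
(2001/route/tribunal) claims are never citable.»  0 estimates; 0∕4 row-D1 binders (hW, hR, D1Tel, D1Rep — `D1Tel` CONCLUDED only from displayed rows);
ROOT M‴ p325680 untouched; NOT (C1), NOT (L2′) beyond `hN`'s name, NOT (T-ID), NOT SDF, NOT D1, NOT BetaPertH, NOT continuum, NOT Clay.  Road «FP» OWNER,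
b2b-balaban-beta-d1-p3 gen 34 (v1, SPEC-46 §B) ∕ gen 35 (§B′ family lift + §C H-side), 2026-08-25.  No existing file touched.
-/

noncomputable section

open scoped BigOperators Matrix

namespace Summit.QuantumFields.BalabanUV.Beta.FP.StepRecursionFeedNestedNamedB

open Matrix Finset Filter
open Literature.Probability.LatticeModels (Torus.proj)
open Literature.MathematicalPhysics.QuantumFieldTheory.Balaban1983to89
open Literature.MathematicalPhysics.QuantumFieldTheory.Balaban1983to89.Beta
open Literature.MathematicalPhysics.QuantumFieldTheory.Balaban1983to89.Beta.Composition (kkt)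
open Literature.MathematicalPhysics.QuantumFieldTheory.Balaban1983to89.Beta.CompositionSingular (effForm flucCov minOp minOpL)
open B4TorusKernel.MultiPeriod (translate)
open B5Prop11Plancherel (fine)
open B6Lemma24Torus (pbox mem_pbox)
open AffineAveraging (Site box toSite unitVec)
open AveragingContoursRooted (ctr ctrOff ctrOff_mem_box)
open OneStepResolventKernel (Fib)
open ExpKernelCalculus (MKer Decays BiLoc VertexFamily VertexFamily₂ shiftK hessKer)
open BalabanStepJetsSucc (wVH)
open Summit.QuantumFields.BalabanUV.Beta.AxialDressingRooted (axEc)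
open Summit.QuantumFields.BalabanUV.Beta.BorderedHessian (stepScale)
open Summit.QuantumFields.BalabanUV.Beta.D1BFx.LogDetSecondVariation (secondVar)
open Summit.QuantumFields.BalabanUV.Beta.FP.KernelPeriodisationFib (Idx perF)
open Summit.QuantumFields.BalabanUV.Beta.SymAveragingHessianCounts (symVhSAt)
open Summit.QuantumFields.BalabanUV.Beta.SymAveragingMixedJetTables (symVh₂SAt)
open Summit.QuantumFields.BalabanUV.Beta.SymShiftedSpread (bhKStepSh)
open Summit.QuantumFields.BalabanUV.Beta.DshAn1 (Dsh)
open Summit.QuantumFields.BalabanUV.Beta.CombChartStepJets (GcombSh)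
open Summit.QuantumFields.BalabanUV.Beta.FP.KernelPeriodisationFibLoc (dper)
open Summit.QuantumFields.BalabanUV.Beta.FP.TorusCombRows (Res)
open Summit.QuantumFields.BalabanUV.Beta.FP.TorusGaugeCovariance (tgrad tdelta)
open Summit.QuantumFields.BalabanUV.Beta.FP.TorusCompositeObjects (towerTorus NParam combF bigP towerGen)
open Summit.QuantumFields.BalabanUV.Beta.FP.TorusCompositeObjectsG (QSym compRowsSym nestedSliceSym)
open Summit.QuantumFields.BalabanUV.Beta.FP.TorusCompositeFP (evalN)
open Summit.QuantumFields.BalabanUV.Beta.GAN24.FineReadoutCauchyFrame (toSite_mem_range)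
open Summit.QuantumFields.BalabanUV.Beta.FP.TorusCompositeSliceG (det_nestedSliceSym_mul_towerGen_ne_zero)
open Summit.QuantumFields.BalabanUV.Beta.FP.TorusCompositeSliceOneShotG (torus_hTW_oneShot_towerSym)
open Summit.QuantumFields.BalabanUV.Beta.FP.TorusCompositeCovarianceSym (compRowsSym_mul_towerGen_succ QtopSym_mul_smul_tgrad_res)
open Summit.QuantumFields.BalabanUV.Beta.FP.TorusCompositeCovarianceOneSym (compIns₁Sym)
open Summit.QuantumFields.BalabanUV.Beta.FP.TorusCompositeCovarianceTwoPolarSym (compIns₂₂Sym)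
open Summit.QuantumFields.BalabanUV.Beta.FP.TorusCompositeCovarianceOneRowsSym (torus_c1_towerSym torus_d1_towerSym)
open Summit.QuantumFields.BalabanUV.Beta.FP.TorusCompositeCovarianceTwoRowsSym (torus_d2_towerSym)
open Summit.QuantumFields.BalabanUV.Beta.FP.TorusCompositeRowsDirectionalSym (Q11f_lin Q21f_lin Q12f_lin_left Q12f_lin_right Q22f_lin_left Q22f_lin_right
  torus_c2_towerSym_polar)
open Summit.QuantumFields.BalabanUV.Beta.FP.NestedStepLawTorusInstance (dvd_fine)
open Summit.QuantumFields.BalabanUV.Beta.FP.PackedLegCombSym (kkt_mul_inv_combSym packedLeg_combSym_eq perF_rules_combSym lattice_letters_combSym)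
open Summit.QuantumFields.BalabanUV.Beta.FP.TowerKernelLawSymB (hessKer_law_tower_sym)
open Summit.QuantumFields.BalabanUV.Beta.FP.TowerUTopClosedSym (nestedColumn_linear)
open Summit.QuantumFields.BalabanUV.Beta.FP.TowerUTopClosedSymB (torus_uTop_towerSym_closed)
open DressedMomentNormalisation (EKer dressedEntry)
open OneStepKernelFamily (TshotOf TbalOf D1Tel)
open HessianTelescopingKKT (wStep)
open Summit.QuantumFields.BalabanUV.Beta.SymSecondOrderTablesAn1 (symTablesAn1S2)
open Summit.QuantumFields.BalabanUV.Beta.CombChartJointEnd (JsB12CombShSym)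
open Summit.QuantumFields.BalabanUV.Beta.CompositeOneShotJetData (Roots Pins JcComp AN VN WN)
open Summit.QuantumFields.BalabanUV.Beta.CompositeOneShotJets (decays_compChart shiftK_compChart)
open Summit.QuantumFields.BalabanUV.Beta.FP.TorusGaugeCovarianceCoarse (coarsePt)
open Summit.QuantumFields.BalabanUV.Beta.FP.NestedStepLawTorusInstance (coarseSlot_injective coarseSlot_range)
open Summit.QuantumFields.BalabanUV.Beta.FP.StepRecursionFeedNestedComp (d1Tel_JcComp_ctr_nested_of_hessKer_laws_wStep)
open Summit.QuantumFields.BalabanUV.Beta.FP.TowerKernelLawNamedB (hessKer_law_tower_named)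
open Summit.QuantumFields.BalabanUV.Beta.FP.TowerHSideRowsClosing (H1f_linear H1f_transpose a1_row)
open InterLevelTransport (SLam)  open StepJetData (wilsonA)
open Summit.QuantumFields.BalabanUV.Beta.SymAveragingHessianCounts (symHessFFAt symLinKerAt)
open Summit.QuantumFields.BalabanUV.Beta.BorderedHessian (bhKStepAt)
open Summit.QuantumFields.BalabanUV.Beta.FP.TorusCompositeCompanionSumG (compSumSym)
open Summit.QuantumFields.BalabanUV.Beta.FP.TorusCompositeCompanionFamilyG (onTowerFamily)

variable {Lc : ℕ} [NeZero Lc]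

set_option synthInstance.maxSize 1024 in
/-- [folklore] **THE END WRAPPER: `D1Tel` AT THE RECORD PAIR FROM THE BOUNDED NAMED TOWER LAW** (SPEC-46 §B).  Per storey `j = n + 1`: `TowerKernelLawNamedB` at
`lev i := n + 1 − i`, `M′ B := fine Lc (Mc B)`, coarse-slot presentation, `σ := Fin 2` with `dv := ![dv n B (μ,0), dv n B (ν,z)]`, N chart `AN (Roots.ctr Lc) (n+1)`
with an2's decay ∕ covariance letters, the H-side rows `hH₁l hH₁t a1` by `TowerHSideRowsClosing` (`Y₁f := 0`); everything else displayed `∀ n`, the (S3-2)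
rows as VERTEX FAMILIES (SPEC-46 §B′); then END-Comp. -/
theorem d1Tel_JcComp_ctr_named (hLc : Odd Lc) (N : ℕ) [NeZero N] (cΛ cB : ℝ) (Pn : Pins)
    -- the coarse box sequence (any growing one) and END-Comp's F ∕ G systems, storey-indexed
    (Mc : ℕ → (Fin (3 + 1) → ℕ)) [∀ B μ, NeZero (Mc B μ)] (hMc : ∀ K : ℕ, ∀ᶠ B in atTop, ∀ i, K ≤ Mc B i)
    (AF : ℕ → MKer (3 + 1) (Fib 3)) (𝒱F : ℕ → Fin (3 + 1) → (Fin (3 + 1) → ℤ) → MKer (3 + 1) (Fib 3))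
    (𝒲F : ℕ → Fin (3 + 1) → (Fin (3 + 1) → ℤ) → Fin (3 + 1) → (Fin (3 + 1) → ℤ) → MKer (3 + 1) (Fib 3))
    (𝒱G : ℕ → Fin (3 + 1) → (Fin (3 + 1) → ℤ) → MKer (3 + 1) (Fib 3))
    (𝒲G : ℕ → Fin (3 + 1) → (Fin (3 + 1) → ℤ) → Fin (3 + 1) → (Fin (3 + 1) → ℤ) → MKer (3 + 1) (Fib 3))
    -- `TowerKernelLawNamedB`'s displayed binders, lifted over the depth `n` (objects `X n …`); the (S3-2) rows in FAMILY form (`∀ n μ y …`)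
    -- #41d-G's binders AT EVERY BOX `B` (generated from its bytes; `X ↦ X B` for every box-dependent binder `X`, `M′ ↦ M′ B`; `Q K hone hId c` box-free; `hSL c0 hTW` box-indexed, R-FP-71)
    -- the (0.4)-SYMMETRISED composite objects PINNED (leaf-06 `TorusCompositeObjectsG` §3), roots `ctrOff (d+1) Lc` at every storey
    {H₀ : ∀ n : ℕ, ∀ B : ℕ, Matrix (↥(pbox (towerTorus Lc (fine Lc (Mc B)) (n + 1))) × Fin (3 + 1)) (↥(pbox (towerTorus Lc (fine Lc (Mc B)) (n + 1))) × Fin (3 + 1)) ℝ}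
    {Q₁₀ : ∀ n : ℕ, ∀ B : ℕ, Matrix (↥(pbox (fine Lc (Mc B))) × Fin (3 + 1)) (↥(pbox (towerTorus Lc (fine Lc (Mc B)) (n + 1))) × Fin (3 + 1)) ℝ}
    {τ₁ : ∀ n : ℕ, ∀ B : ℕ, Matrix (NParam Lc (fine Lc (fine Lc (Mc B))) (fun k => (fun _ : ℕ => ctrOff (3 + 1) Lc) (k + 1)) n) (↥(pbox (towerTorus Lc (fine Lc (Mc B)) (n + 1))) × Fin (3 + 1)) ℝ}
    (hH₀ : ∀ n : ℕ, ∀ B : ℕ, ((H₀ n) B) = (perF (towerTorus Lc (fine Lc (Mc B)) (n + 1)) (bhKStepSh 3 Lc (Dsh Lc) ((n + 1 - (n + 1))))).submatrix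
        (fun b : (↥(pbox (towerTorus Lc (fine Lc (Mc B)) (n + 1))) × Fin (3 + 1)) => ((b.1, Sum.inl b.2) : Idx (towerTorus Lc (fine Lc (Mc B)) (n + 1)) (Fib 3)))
        (fun b : (↥(pbox (towerTorus Lc (fine Lc (Mc B)) (n + 1))) × Fin (3 + 1)) => ((b.1, Sum.inl b.2) : Idx (towerTorus Lc (fine Lc (Mc B)) (n + 1)) (Fib 3))))
    (hQ₁₀ : ∀ n : ℕ, ∀ B : ℕ, ((Q₁₀ n) B) = compRowsSym Lc (fine Lc (Mc B)) (fun i : ℕ => n + 1 - i) (fun _ : ℕ => ctrOff (3 + 1) Lc) (n + 1))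
    (hτ₁ : ∀ n : ℕ, ∀ B : ℕ, ((τ₁ n) B) = bigP Lc (fine Lc (fine Lc (Mc B))) (fun k => (fun _ : ℕ => ctrOff (3 + 1) Lc) (k + 1)) (fun _ => toSite_mem_range (ctrOff_mem_box (d := 3 + 1) (Nat.one_le_iff_ne_zero.mpr (NeZero.ne Lc)))) n)
    {τ₂ : ∀ n : ℕ, ∀ B : ℕ, Matrix (Res (toSite (ctrOff (3 + 1) Lc)) Lc (fine Lc (Mc B))) (↥(pbox (fine Lc (Mc B))) × Fin (3 + 1)) ℝ}
    (hτ₂ : ∀ n : ℕ, ∀ B : ℕ, ((τ₂ n) B) = combF Lc (fine Lc (Mc B)) ((fun _ : ℕ => ctrOff (3 + 1) Lc) 0))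
    -- the top step's (0.4)-symmetrised averaging rows (level `lev 0`), PINNED in (B)'s slot presentation; its comb-KKT `htop` discharged inside
    {Q₂₀ : ∀ n : ℕ, ∀ B : ℕ, Matrix ((↥(pbox (Mc B)) × Fin (3 + 1))) (↥(pbox (fine Lc (Mc B))) × Fin (3 + 1)) ℝ}
    (hQ₂₀ : ∀ n : ℕ, ∀ B : ℕ, ((Q₂₀ n) B) = (perF (fine Lc (Mc B)) (bhKStepSh 3 Lc (Dsh Lc) ((n + 1 - 0)))).submatrix (fun a : ((↥(pbox (Mc B)) × Fin (3 + 1))) => ((coarsePt (Mc B) Lc a.1, Sum.inr (a.2)) : Idx (fine Lc (Mc B)) (Fib 3)))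
        (fun b : ↥(pbox (fine Lc (Mc B))) × Fin (3 + 1) => ((b.1, Sum.inl b.2) : Idx (fine Lc (Mc B)) (Fib 3))))
    {W₀ : ∀ n : ℕ, ∀ B : ℕ, Matrix (↥(pbox (towerTorus Lc (fine Lc (Mc B)) (n + 1))) × Fin (3 + 1)) (NParam Lc (fine Lc (Mc B)) (fun _ : ℕ => ctrOff (3 + 1) Lc) (n + 1)) ℝ}
    (hW₀ : ∀ n : ℕ, ∀ B : ℕ, ((W₀ n) B) = towerGen Lc (fine Lc (Mc B)) (fun _ : ℕ => ctrOff (3 + 1) Lc) (n + 1))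
    {P : ∀ n : ℕ, ∀ B : ℕ, Matrix (NParam Lc (fine Lc (Mc B)) (fun _ : ℕ => ctrOff (3 + 1) Lc) (n + 1)) (↥(pbox (towerTorus Lc (fine Lc (Mc B)) (n + 1))) × Fin (3 + 1)) ℝ}
    (hP : ∀ n : ℕ, ∀ B : ℕ, ((P n) B) = bigP Lc (fine Lc (Mc B)) (fun _ : ℕ => ctrOff (3 + 1) Lc) (fun _ => toSite_mem_range (ctrOff_mem_box (d := 3 + 1) (Nat.one_le_iff_ne_zero.mpr (NeZero.ne Lc)))) (n + 1))
    -- the step constant of the chart transport (#21's `c`), the (COV-m) order-0 image PINNED, the one-shot resolvent words and `𝔔₀` NAMED (#21 VERBATIM)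
    (c : ∀ n : ℕ, ℝ)
    {Dbar : ∀ n : ℕ, ∀ B : ℕ, Matrix (↥(pbox (fine Lc (Mc B))) × Fin (3 + 1)) (Res (toSite (ctrOff (3 + 1) Lc)) Lc (fine Lc (Mc B))) ℝ}
    (hDbar : ∀ n : ℕ, ∀ B : ℕ, ((Dbar n) B) = (∏ i ∈ range (n + 1), (stepScale 3 Lc ((n + 1 - (i + 1))) * ((box (3 + 1) Lc).card : ℝ))) •
        (tgrad (fine Lc (Mc B))).submatrix (fun a : (↥(pbox (fine Lc (Mc B))) × Fin (3 + 1)) => ((a.1, Sum.inl a.2) : Idx (fine Lc (Mc B)) (Fib 3))) (fun t : (Res (toSite (ctrOff (3 + 1) Lc)) Lc (fine Lc (Mc B))) => (t.1 : ↥(pbox (fine Lc (Mc B))))))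
    {Γ : ∀ n : ℕ, ∀ B : ℕ, Matrix (↥(pbox (towerTorus Lc (fine Lc (Mc B)) (n + 1))) × Fin (3 + 1)) (↥(pbox (towerTorus Lc (fine Lc (Mc B)) (n + 1))) × Fin (3 + 1)) ℝ}
    {I : ∀ n : ℕ, ∀ B : ℕ, Matrix (↥(pbox (towerTorus Lc (fine Lc (Mc B)) (n + 1))) × Fin (3 + 1)) ((↥(pbox (fine Lc (Mc B))) × Fin (3 + 1)) ⊕ (NParam Lc (fine Lc (fine Lc (Mc B))) (fun k => (fun _ : ℕ => ctrOff (3 + 1) Lc) (k + 1)) n)) ℝ}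
    {L : ∀ n : ℕ, ∀ B : ℕ, Matrix ((↥(pbox (fine Lc (Mc B))) × Fin (3 + 1)) ⊕ (NParam Lc (fine Lc (fine Lc (Mc B))) (fun k => (fun _ : ℕ => ctrOff (3 + 1) Lc) (k + 1)) n)) (↥(pbox (towerTorus Lc (fine Lc (Mc B)) (n + 1))) × Fin (3 + 1)) ℝ}
    {S : ∀ n : ℕ, ∀ B : ℕ, Matrix ((↥(pbox (fine Lc (Mc B))) × Fin (3 + 1)) ⊕ (NParam Lc (fine Lc (fine Lc (Mc B))) (fun k => (fun _ : ℕ => ctrOff (3 + 1) Lc) (k + 1)) n)) ((↥(pbox (fine Lc (Mc B))) × Fin (3 + 1)) ⊕ (NParam Lc (fine Lc (fine Lc (Mc B))) (fun k => (fun _ : ℕ => ctrOff (3 + 1) Lc) (k + 1)) n)) ℝ}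
    (hΓ : ∀ n : ℕ, ∀ B : ℕ, flucCov ((H₀ n) B) (fromRows ((Q₁₀ n) B) ((τ₁ n) B)) = ((Γ n) B))
    (hI : ∀ n : ℕ, ∀ B : ℕ, minOp ((H₀ n) B) (fromRows ((Q₁₀ n) B) ((τ₁ n) B)) = ((I n) B))
    (hL : ∀ n : ℕ, ∀ B : ℕ, minOpL ((H₀ n) B) (fromRows ((Q₁₀ n) B) ((τ₁ n) B)) = ((L n) B))
    (hS : ∀ n : ℕ, ∀ B : ℕ, effForm ((H₀ n) B) (fromRows ((Q₁₀ n) B) ((τ₁ n) B)) = ((S n) B))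
    {𝔔₀ : ∀ n : ℕ, ∀ B : ℕ, Matrix ((↥(pbox (Mc B)) × Fin (3 + 1))) (↥(pbox (towerTorus Lc (fine Lc (Mc B)) (n + 1))) × Fin (3 + 1)) ℝ}
    (h𝔔₀ : ∀ n : ℕ, ∀ B : ℕ, ((Q₂₀ n) B) * ((Q₁₀ n) B) = ((𝔔₀ n) B))
    -- the direction module FIXED (R-FP-72, SPEC-45 v1.6 §A row 6): directions = TOP one-shot SOURCE weights `v : κ B → ℝ`; finest-level direction `hv B v` PINNED to the
    -- NESTED COMPOSITE COLUMN `I · (minOp S₁₁ [Q₂₀; τ₂] · (v, 0), 0)` (leaf-06 G-5's `h`); tree-gauge ∕ top-generator read-outs `lv Xbf` DISPLAYED (linear; enter the one-shot namings only)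
    {hv : ∀ n : ℕ, ∀ B : ℕ, ((↥(pbox (Mc B)) × Fin (3 + 1)) → ℝ) → ((↥(pbox (towerTorus Lc (fine Lc (Mc B)) (n + 1))) × Fin (3 + 1)) → ℝ)}
    (hhv : ∀ n : ℕ, ∀ B : ℕ, ∀ v, ((hv n) B) v = ((I n) B) *ᵥ Sum.elim (minOp ((S n) B).toBlocks₁₁ (fromRows ((Q₂₀ n) B) ((τ₂ n) B)) *ᵥ Sum.elim v 0) 0)
    (lv : ∀ n : ℕ, ∀ B : ℕ, ((↥(pbox (Mc B)) × Fin (3 + 1)) → ℝ) → (↥(pbox (towerTorus Lc (fine Lc (Mc B)) (n + 1))) → ℝ))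
    (hlv : ∀ n : ℕ, ∀ B : ℕ, ∀ (r : ℝ) (x y : ((↥(pbox (Mc B)) × Fin (3 + 1)) → ℝ)), ((lv n) B) (r • x + y) = r • ((lv n) B) x + ((lv n) B) y)
    (Xbf : ∀ n : ℕ, ∀ B : ℕ, ((↥(pbox (Mc B)) × Fin (3 + 1)) → ℝ) → Matrix ((↥(pbox (Mc B)) × Fin (3 + 1))) ((↥(pbox (Mc B)) × Fin (3 + 1))) ℝ)
    (hXbf : ∀ n : ℕ, ∀ B : ℕ, ∀ (r : ℝ) (x y : ((↥(pbox (Mc B)) × Fin (3 + 1)) → ℝ)), ((Xbf n) B) (r • x + y) = r • ((Xbf n) B) x + ((Xbf n) B) y)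
    -- #21's displayed jets AS FUNCTIONS of the direction: first order linear, second order in two slots (linear in each; the door reads the diagonal)
    (H₁f : ∀ n : ℕ, ∀ B : ℕ, ((↥(pbox (Mc B)) × Fin (3 + 1)) → ℝ) → Matrix (↥(pbox (towerTorus Lc (fine Lc (Mc B)) (n + 1))) × Fin (3 + 1)) (↥(pbox (towerTorus Lc (fine Lc (Mc B)) (n + 1))) × Fin (3 + 1)) ℝ)
    {Q₁₁f : ∀ n : ℕ, ∀ B : ℕ, ((↥(pbox (Mc B)) × Fin (3 + 1)) → ℝ) → Matrix (↥(pbox (fine Lc (Mc B))) × Fin (3 + 1)) (↥(pbox (towerTorus Lc (fine Lc (Mc B)) (n + 1))) × Fin (3 + 1)) ℝ}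
    (hQ₁₁f : ∀ n : ℕ, ∀ B : ℕ, ∀ v, ((Q₁₁f n) B) v = (c n) • compIns₁Sym Lc (fine Lc (Mc B)) (fun i : ℕ => n + 1 - i) (fun _ : ℕ => ctrOff (3 + 1) Lc) (n + 1) (((hv n) B) v))
    {Q₂₁f : ∀ n : ℕ, ∀ B : ℕ, ((↥(pbox (Mc B)) × Fin (3 + 1)) → ℝ) → Matrix ((↥(pbox (Mc B)) × Fin (3 + 1))) (↥(pbox (fine Lc (Mc B))) × Fin (3 + 1)) ℝ}
    (hQ₂₁f : ∀ n : ℕ, ∀ B : ℕ, ∀ v, ((Q₂₁f n) B) v = ∑ a' : (↥(pbox (fine Lc (Mc B))) × Fin (3 + 1)), (((c n) * (((Lc : ℝ) ^ (3 + 1) * stepScale 3 Lc ((n + 1 - 0))) * (∏ i ∈ range (n + 1), (stepScale 3 Lc ((n + 1 - (i + 1))) * ((box (3 + 1) Lc).card : ℝ)))⁻¹)) * (compRowsSym Lc (fine Lc (Mc B)) (fun i : ℕ => n + 1 - i) (fun _ : ℕ => ctrOff (3 + 1) Lc) (n + 1) *ᵥ (((hv n) B) v)) a') • (perF (fine Lc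 (Mc B)) (dper (fine Lc (Mc B)) (symVhSAt (ctr (3 + 1) Lc) 3 Lc rfl a'.2 (a'.1 : Site (3 + 1))))).submatrix (fun k : (↥(pbox (Mc B)) × Fin (3 + 1)) => (((coarsePt (Mc B) Lc k.1, Sum.inr (k.2)) : Idx (fine Lc (Mc B)) (Fib 3)))) (fun b : (↥(pbox (fine Lc (Mc B))) × Fin (3 + 1)) => ((b.1, Sum.inl b.2) : Idx (fine Lc (Mc B)) (Fib 3))))
    (H₂f : ∀ n : ℕ, ∀ B : ℕ, ((↥(pbox (Mc B)) × Fin (3 + 1)) → ℝ) → ((↥(pbox (Mc B)) × Fin (3 + 1)) → ℝ) → Matrix (↥(pbox (towerTorus Lc (fine Lc (Mc B)) (n + 1))) × Fin (3 + 1)) (↥(pbox (towerTorus Lc (fine Lc (Mc B)) (n + 1))) × Fin (3 + 1)) ℝ)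
    (hH₂l : ∀ n : ℕ, ∀ B : ℕ, ∀ (r : ℝ) (x y z : ((↥(pbox (Mc B)) × Fin (3 + 1)) → ℝ)), ((H₂f n) B) (r • x + y) z = r • ((H₂f n) B) x z + ((H₂f n) B) y z)
    (hH₂r : ∀ n : ℕ, ∀ B : ℕ, ∀ (r : ℝ) (x y z : ((↥(pbox (Mc B)) × Fin (3 + 1)) → ℝ)), ((H₂f n) B) z (r • x + y) = r • ((H₂f n) B) z x + ((H₂f n) B) z y)
    {Q₁₂f : ∀ n : ℕ, ∀ B : ℕ, ((↥(pbox (Mc B)) × Fin (3 + 1)) → ℝ) → ((↥(pbox (Mc B)) × Fin (3 + 1)) → ℝ) → Matrix (↥(pbox (fine Lc (Mc B))) × Fin (3 + 1)) (↥(pbox (towerTorus Lc (fine Lc (Mc B)) (n + 1))) × Fin (3 + 1)) ℝ}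
    (hQ₁₂f : ∀ n : ℕ, ∀ B : ℕ, ∀ v v', ((Q₁₂f n) B) v v' = (c n) ^ 2 • compIns₂₂Sym Lc (fine Lc (Mc B)) (fun i : ℕ => n + 1 - i) (fun _ : ℕ => ctrOff (3 + 1) Lc) (n + 1) (((hv n) B) v) (((hv n) B) v'))
    {Q₂₂f : ∀ n : ℕ, ∀ B : ℕ, ((↥(pbox (Mc B)) × Fin (3 + 1)) → ℝ) → ((↥(pbox (Mc B)) × Fin (3 + 1)) → ℝ) → Matrix ((↥(pbox (Mc B)) × Fin (3 + 1))) (↥(pbox (fine Lc (Mc B))) × Fin (3 + 1)) ℝ}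
    (hQ₂₂f : ∀ n : ℕ, ∀ B : ℕ, ∀ v v', ((Q₂₂f n) B) v v' = ((Lc : ℝ) ^ (3 + 1) * stepScale 3 Lc ((n + 1 - 0)))⁻¹ •
        ∑ b : (↥(pbox (fine Lc (Mc B))) × Fin (3 + 1)), ∑ b' : (↥(pbox (fine Lc (Mc B))) × Fin (3 + 1)), ((((c n) * (((Lc : ℝ) ^ (3 + 1) * stepScale 3 Lc ((n + 1 - 0))) * (∏ i ∈ range (n + 1), (stepScale 3 Lc ((n + 1 - (i + 1))) * ((box (3 + 1) Lc).card : ℝ)))⁻¹)) * (compRowsSym Lc (fine Lc (Mc B)) (fun i : ℕ => n + 1 - i) (fun _ : ℕ => ctrOff (3 + 1) Lc) (n + 1) *ᵥ (((hv n) B) v)) b) * (((c n) * (((Lc : ℝ) ^ (3 + 1) * stepScale 3 Lc ((n + 1 - 0))) * (∏ i ∈ range (n + 1), (stepScale 3 Lc ((n + 1 - (i + 1))) * ((box (3 + 1) Lc).card : ℝ)))⁻¹)) * (compRowsSym Lc (fine Lc (Mc B)) (fun i : ℕ => n + 1 - i) (fun _ : ℕ => ctrOff (3 + 1) Lc) (n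 + 1) *ᵥ (((hv n) B) v')) b')) •
          (perF (fine Lc (Mc B)) (dper (fine Lc (Mc B)) (fun x z a e => ∑' m : Site (3 + 1), (1 / 2 : ℝ) *
            (symVh₂SAt (ctr (3 + 1) Lc) Lc b.2 (b.1 : Site (3 + 1)) b'.2 (translate (fine Lc (Mc B)) (b'.1 : Site (3 + 1)) m) x z a e
              + symVh₂SAt (ctr (3 + 1) Lc) Lc b'.2 (translate (fine Lc (Mc B)) (b'.1 : Site (3 + 1)) m) b.2 (b.1 : Site (3 + 1)) x z a e)))).submatrix
            (fun k : (↥(pbox (Mc B)) × Fin (3 + 1)) => (((coarsePt (Mc B) Lc k.1, Sum.inr (k.2)) : Idx (fine Lc (Mc B)) (Fib 3)))) (fun b : (↥(pbox (fine Lc (Mc B))) × Fin (3 + 1)) => ((b.1, Sum.inl b.2) : Idx (fine Lc (Mc B)) (Fib 3))))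
    -- #21's composite and one-shot NAMINGS as functions (`h𝔔₁ h𝔔₂ k1 k2 q1 q2`; `X := −(c • diagonal (λ ∘ pr))` at `λ := lv v`; order 2 in two slots)
    (𝔔₁f : ∀ n : ℕ, ∀ B : ℕ, ((↥(pbox (Mc B)) × Fin (3 + 1)) → ℝ) → Matrix ((↥(pbox (Mc B)) × Fin (3 + 1))) (↥(pbox (towerTorus Lc (fine Lc (Mc B)) (n + 1))) × Fin (3 + 1)) ℝ)
    (h𝔔₁ : ∀ n : ℕ, ∀ B : ℕ, ∀ v, ((Q₂₁f n) B) v * ((Q₁₀ n) B) + ((Q₂₀ n) B) * ((Q₁₁f n) B) v = ((𝔔₁f n) B) v)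
    (𝔔₂f : ∀ n : ℕ, ∀ B : ℕ, ((↥(pbox (Mc B)) × Fin (3 + 1)) → ℝ) → ((↥(pbox (Mc B)) × Fin (3 + 1)) → ℝ) → Matrix ((↥(pbox (Mc B)) × Fin (3 + 1))) (↥(pbox (towerTorus Lc (fine Lc (Mc B)) (n + 1))) × Fin (3 + 1)) ℝ)
    (h𝔔₂ : ∀ n : ℕ, ∀ B : ℕ, ∀ v v', ((Q₂₂f n) B) v v' * ((Q₁₀ n) B) + ((Q₂₁f n) B) v * ((Q₁₁f n) B) v' + (((Q₂₁f n) B) v * ((Q₁₁f n) B) v' + ((Q₂₀ n) B) * ((Q₁₂f n) B) v v') = ((𝔔₂f n) B) v v')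
    (H'₁f : ∀ n : ℕ, ∀ B : ℕ, ((↥(pbox (Mc B)) × Fin (3 + 1)) → ℝ) → Matrix (↥(pbox (towerTorus Lc (fine Lc (Mc B)) (n + 1))) × Fin (3 + 1)) (↥(pbox (towerTorus Lc (fine Lc (Mc B)) (n + 1))) × Fin (3 + 1)) ℝ)
    (hH'₁f : ∀ n : ℕ, ∀ B : ℕ, ∀ v, ((H'₁f n) B) v = -((-((c n) • Matrix.diagonal (fun b : (↥(pbox (towerTorus Lc (fine Lc (Mc B)) (n + 1))) × Fin (3 + 1)) => ((lv n) B) v b.1)))ᵀ * ((H₀ n) B)) + ((H₁f n) B) v + ((H₀ n) B) * (-((c n) • Matrix.diagonal (fun b : (↥(pbox (towerTorus Lc (fine Lc (Mc B)) (n + 1))) × Fin (3 + 1)) => ((lv n) B) v b.1))))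
    (H'₂f : ∀ n : ℕ, ∀ B : ℕ, ((↥(pbox (Mc B)) × Fin (3 + 1)) → ℝ) → ((↥(pbox (Mc B)) × Fin (3 + 1)) → ℝ) → Matrix (↥(pbox (towerTorus Lc (fine Lc (Mc B)) (n + 1))) × Fin (3 + 1)) (↥(pbox (towerTorus Lc (fine Lc (Mc B)) (n + 1))) × Fin (3 + 1)) ℝ)
    (hH'₂f : ∀ n : ℕ, ∀ B : ℕ, ∀ v v', ((H'₂f n) B) v v' = ((-((c n) • Matrix.diagonal (fun b : (↥(pbox (towerTorus Lc (fine Lc (Mc B)) (n + 1))) × Fin (3 + 1)) => ((lv n) B) v b.1))) * (-((c n) • Matrix.diagonal (fun b : (↥(pbox (towerTorus Lc (fine Lc (Mc B)) (n + 1))) × Fin (3 + 1)) => ((lv n) B) v' b.1))))ᵀ * ((H₀ n) B) + (-((-((c n) • Matrix.diagonal (fun b : (↥(pbox (towerTorus Lc (fine Lc (Mc B)) (n + 1))) × Fin (3 + 1)) => ((lv n) B) v b.1)))ᵀ * ((H₁f n) B) v') + -((-((c n) • Matrix.diagonal (fun b : (↥(pbox (towerTorus Lc (fine Lc (Mc B))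 (n + 1))) × Fin (3 + 1)) => ((lv n) B) v b.1)))ᵀ * ((H₀ n) B) * (-((c n) • Matrix.diagonal (fun b : (↥(pbox (towerTorus Lc (fine Lc (Mc B)) (n + 1))) × Fin (3 + 1)) => ((lv n) B) v' b.1)))))
      + ((-((-((c n) • Matrix.diagonal (fun b : (↥(pbox (towerTorus Lc (fine Lc (Mc B)) (n + 1))) × Fin (3 + 1)) => ((lv n) B) v b.1)))ᵀ * ((H₁f n) B) v') + -((-((c n) • Matrix.diagonal (fun b : (↥(pbox (towerTorus Lc (fine Lc (Mc B)) (n + 1))) × Fin (3 + 1)) => ((lv n) B) v b.1)))ᵀ * ((H₀ n) B) * (-((c n) • Matrix.diagonal (fun b : (↥(pbox (towerTorus Lc (fine Lc (Mc B)) (n + 1))) × Fin (3 + 1)) => ((lv n) B) v' b.1))))) + (((H₂f n) B) v v' + ((H₁f n) B) v * (-((c n) • Matrix.diagonal (fun b : (↥(pbox (towerTorus Lc (fine Lc (Mc B)) (n + 1))) × Fin (3 + 1)) => ((lv n) B) v' b.1))) + (((H₁f n) B) v * (-((c n) • Matrix.diagonal (fun b : (↥(pbox (towerTorus Lc (fine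 Lc (Mc B)) (n + 1))) × Fin (3 + 1)) => ((lv n) B) v' b.1))) + ((H₀ n) B) * ((-((c n) • Matrix.diagonal (fun b : (↥(pbox (towerTorus Lc (fine Lc (Mc B)) (n + 1))) × Fin (3 + 1)) => ((lv n) B) v b.1))) * (-((c n) • Matrix.diagonal (fun b : (↥(pbox (towerTorus Lc (fine Lc (Mc B)) (n + 1))) × Fin (3 + 1)) => ((lv n) B) v' b.1))))))))
    (𝔔'₁f : ∀ n : ℕ, ∀ B : ℕ, ((↥(pbox (Mc B)) × Fin (3 + 1)) → ℝ) → Matrix ((↥(pbox (Mc B)) × Fin (3 + 1))) (↥(pbox (towerTorus Lc (fine Lc (Mc B)) (n + 1))) × Fin (3 + 1)) ℝ)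
    (h𝔔'₁f : ∀ n : ℕ, ∀ B : ℕ, ∀ v, ((𝔔'₁f n) B) v = ((Xbf n) B) v * ((𝔔₀ n) B) + ((𝔔₁f n) B) v + ((𝔔₀ n) B) * (-((c n) • Matrix.diagonal (fun b : (↥(pbox (towerTorus Lc (fine Lc (Mc B)) (n + 1))) × Fin (3 + 1)) => ((lv n) B) v b.1))))
    (𝔔'₂f : ∀ n : ℕ, ∀ B : ℕ, ((↥(pbox (Mc B)) × Fin (3 + 1)) → ℝ) → ((↥(pbox (Mc B)) × Fin (3 + 1)) → ℝ) → Matrix ((↥(pbox (Mc B)) × Fin (3 + 1))) (↥(pbox (towerTorus Lc (fine Lc (Mc B)) (n + 1))) × Fin (3 + 1)) ℝ)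
    (h𝔔'₂f : ∀ n : ℕ, ∀ B : ℕ, ∀ v v', ((𝔔'₂f n) B) v v' = ((Xbf n) B) v * ((Xbf n) B) v' * ((𝔔₀ n) B) + (((Xbf n) B) v * ((𝔔₁f n) B) v' + ((Xbf n) B) v * ((𝔔₀ n) B) * (-((c n) • Matrix.diagonal (fun b : (↥(pbox (towerTorus Lc (fine Lc (Mc B)) (n + 1))) × Fin (3 + 1)) => ((lv n) B) v' b.1))))
      + ((((Xbf n) B) v * ((𝔔₁f n) B) v' + ((Xbf n) B) v * ((𝔔₀ n) B) * (-((c n) • Matrix.diagonal (fun b : (↥(pbox (towerTorus Lc (fine Lc (Mc B)) (n + 1))) × Fin (3 + 1)) => ((lv n) B) v' b.1)))) + (((𝔔₂f n) B) v v' + ((𝔔₁f n) B) v * (-((c n) • Matrix.diagonal (fun b : (↥(pbox (towerTorus Lc (fine Lc (Mc B)) (n + 1))) × Fin (3 + 1)) => ((lv n) B) v' b.1))) + (((𝔔₁f n) B) v * (-((c n) • Matrix.diagonal (fun b : (↥(pbox (towerTorus Lc (fine Lc (Mc B)) (n + 1))) × Fin (3 + 1)) => ((lv n) B) v' b.1)))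 + ((𝔔₀ n) B) * ((-((c n) • Matrix.diagonal (fun b : (↥(pbox (towerTorus Lc (fine Lc (Mc B)) (n + 1))) × Fin (3 + 1)) => ((lv n) B) v b.1))) * (-((c n) • Matrix.diagonal (fun b : (↥(pbox (towerTorus Lc (fine Lc (Mc B)) (n + 1))) × Fin (3 + 1)) => ((lv n) B) v' b.1))))))))
    -- #21's generator jets by their closed forms at `h := hv v` (weight `h`), per direction
    (W₁f W₂f : ∀ n : ℕ, ∀ B : ℕ, ((↥(pbox (Mc B)) × Fin (3 + 1)) → ℝ) → Matrix (↥(pbox (towerTorus Lc (fine Lc (Mc B)) (n + 1))) × Fin (3 + 1)) (NParam Lc (fine Lc (Mc B)) (fun _ : ℕ => ctrOff (3 + 1) Lc) (n + 1)) ℝ)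
    (hW₁f : ∀ n : ℕ, ∀ B : ℕ, ∀ v, ((W₁f n) B) v = Matrix.of fun (b : (↥(pbox (towerTorus Lc (fine Lc (Mc B)) (n + 1))) × Fin (3 + 1))) (e : (NParam Lc (fine Lc (Mc B)) (fun _ : ℕ => ctrOff (3 + 1) Lc) (n + 1))) => -((c n) * ((hv n) B) v b * evalN Lc (fine Lc (Mc B)) (fun _ : ℕ => ctrOff (3 + 1) Lc) (n + 1) (fun b' : (↥(pbox (towerTorus Lc (fine Lc (Mc B)) (n + 1))) × Fin (3 + 1)) => (b'.1 : Site (3 + 1)) + unitVec b'.2) b e))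
    (hW₂f : ∀ n : ℕ, ∀ B : ℕ, ∀ v, ((W₂f n) B) v = Matrix.of fun (b : (↥(pbox (towerTorus Lc (fine Lc (Mc B)) (n + 1))) × Fin (3 + 1))) (e : (NParam Lc (fine Lc (Mc B)) (fun _ : ℕ => ctrOff (3 + 1) Lc) (n + 1))) => ((c n) * ((hv n) B) v b) ^ 2 * evalN Lc (fine Lc (Mc B)) (fun _ : ℕ => ctrOff (3 + 1) Lc) (n + 1) (fun b' : (↥(pbox (towerTorus Lc (fine Lc (Mc B)) (n + 1))) × Fin (3 + 1)) => (b'.1 : Site (3 + 1)) + unitVec b'.2) b e)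
    -- the (COV-m) order-1∕2 images PINNED (leaf-02 R-22 ∕ R-27's `D̄₁ D̄₂`: tip-type jets of the transported direction `compRowsSym · hv B v`); the (WARD-m) sources free
    {Db₁f Db₂f : ∀ n : ℕ, ∀ B : ℕ, ((↥(pbox (Mc B)) × Fin (3 + 1)) → ℝ) → Matrix (↥(pbox (fine Lc (Mc B))) × Fin (3 + 1)) (Res (toSite (ctrOff (3 + 1) Lc)) Lc (fine Lc (Mc B))) ℝ}
    (hDb₁f : ∀ n : ℕ, ∀ B : ℕ, ∀ v, ((Db₁f n) B) v = Matrix.of fun (a : (↥(pbox (fine Lc (Mc B))) × Fin (3 + 1))) (t : (Res (toSite (ctrOff (3 + 1) Lc)) Lc (fine Lc (Mc B)))) => -((c n) * (compRowsSym Lc (fine Lc (Mc B)) (fun i : ℕ => n + 1 - i) (fun _ : ℕ => ctrOff (3 + 1) Lc) (n + 1) *ᵥ (((hv n) B) v)) a * tdelta (fine Lc (Mc B)) ((a.1 : Site (3 + 1)) + unitVec a.2) t.1))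
    (hDb₂f : ∀ n : ℕ, ∀ B : ℕ, ∀ v, ((Db₂f n) B) v = Matrix.of fun (a : (↥(pbox (fine Lc (Mc B))) × Fin (3 + 1))) (t : (Res (toSite (ctrOff (3 + 1) Lc)) Lc (fine Lc (Mc B)))) => ((c n) ^ 2 * (∏ i ∈ range (n + 1), (stepScale 3 Lc ((n + 1 - (i + 1))) * ((box (3 + 1) Lc).card : ℝ)))⁻¹) * ((compRowsSym Lc (fine Lc (Mc B)) (fun i : ℕ => n + 1 - i) (fun _ : ℕ => ctrOff (3 + 1) Lc) (n + 1) *ᵥ (((hv n) B) v)) a) ^ 2 * tdelta (fine Lc (Mc B)) ((a.1 : Site (3 + 1)) + unitVec a.2) t.1)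
    (Y₂f : ∀ n : ℕ, ∀ B : ℕ, ((↥(pbox (Mc B)) × Fin (3 + 1)) → ℝ) → Matrix ((↥(pbox (Mc B)) × Fin (3 + 1))) (NParam Lc (fine Lc (Mc B)) (fun _ : ℕ => ctrOff (3 + 1) Lc) (n + 1)) ℝ)
    -- the `G`-side DRESSED WORDS, NAMED (#36b's shapes at `B := [Q₁₁f v; 0]`)
    (Gw₁f : ∀ n : ℕ, ∀ B : ℕ, ((↥(pbox (Mc B)) × Fin (3 + 1)) → ℝ) → Matrix (↥(pbox (fine Lc (Mc B))) × Fin (3 + 1)) (↥(pbox (fine Lc (Mc B))) × Fin (3 + 1)) ℝ)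
    (hGw₁f : ∀ n : ℕ, ∀ B : ℕ, ∀ v, ((Gw₁f n) B) v = ((((L n) B) * (((H₁f n) B) v) - ((S n) B) * (fromRows (((Q₁₁f n) B) v) (0 : Matrix (NParam Lc (fine Lc (fine Lc (Mc B))) (fun k => (fun _ : ℕ => ctrOff (3 + 1) Lc) (k + 1)) n) (↥(pbox (towerTorus Lc (fine Lc (Mc B)) (n + 1))) × Fin (3 + 1)) ℝ))) * ((I n) B) + ((L n) B) * (fromRows (((Q₁₁f n) B) v) (0 : Matrix (NParam Lc (fine Lc (fine Lc (Mc B))) (fun k => (fun _ : ℕ => ctrOff (3 + 1) Lc) (k + 1)) n) (↥(pbox (towerTorus Lc (fine Lc (Mc B)) (n + 1))) × Fin (3 + 1)) ℝ))ᵀ * ((S n) B)).toBlocks₁₁)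
    (Gw₂f : ∀ n : ℕ, ∀ B : ℕ, ((↥(pbox (Mc B)) × Fin (3 + 1)) → ℝ) → ((↥(pbox (Mc B)) × Fin (3 + 1)) → ℝ) → Matrix (↥(pbox (fine Lc (Mc B))) × Fin (3 + 1)) (↥(pbox (fine Lc (Mc B))) × Fin (3 + 1)) ℝ)
    (hGw₂f : ∀ n : ℕ, ∀ B : ℕ, ∀ v v', ((Gw₂f n) B) v v' =
      ((((-((((L n) B) * (((H₁f n) B) v) - ((S n) B) * (fromRows (((Q₁₁f n) B) v) (0 : Matrix (NParam Lc (fine Lc (fine Lc (Mc B))) (fun k => (fun _ : ℕ => ctrOff (3 + 1) Lc) (k + 1)) n) (↥(pbox (towerTorus Lc (fine Lc (Mc B)) (n + 1))) × Fin (3 + 1)) ℝ))) * ((Γ n) B) - ((L n) B) * (fromRows (((Q₁₁f n) B) v) (0 : Matrix (NParam Lc (fine Lc (fine Lc (Mc B))) (fun k => (fun _ : ℕ => ctrOff (3 + 1) Lc) (k + 1)) n) (↥(pbox (towerTorus Lc (fine Lc (Mc B)) (n + 1))) × Fin (3 + 1)) ℝ))ᵀ * ((L n) B)) * (((H₁f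 n) B) v') + ((L n) B) * (((H₂f n) B) v v')
          - (((((L n) B) * (((H₁f n) B) v) - ((S n) B) * (fromRows (((Q₁₁f n) B) v) (0 : Matrix (NParam Lc (fine Lc (fine Lc (Mc B))) (fun k => (fun _ : ℕ => ctrOff (3 + 1) Lc) (k + 1)) n) (↥(pbox (towerTorus Lc (fine Lc (Mc B)) (n + 1))) × Fin (3 + 1)) ℝ))) * ((I n) B) + ((L n) B) * (fromRows (((Q₁₁f n) B) v) (0 : Matrix (NParam Lc (fine Lc (fine Lc (Mc B))) (fun k => (fun _ : ℕ => ctrOff (3 + 1) Lc) (k + 1)) n) (↥(pbox (towerTorus Lc (fine Lc (Mc B)) (n + 1))) × Fin (3 + 1)) ℝ))ᵀ * ((S n) B)) * (fromRows (((Q₁₁f n) B) v') (0 : Matrix (NParam Lc (fine Lc (fine Lc (Mc B))) (fun k => (fun _ : ℕ => ctrOff (3 + 1) Lc) (k + 1)) n) (↥(pbox (towerTorus Lc (fine Lc (Mc B)) (n + 1))) × Fin (3 + 1)) ℝ)) + ((S n) B) * (fromRows (((Q₁₂f n) B) v v') (0 : Matrix (NParam Lc (fine Lc (fine Lc (Mc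 B))) (fun k => (fun _ : ℕ => ctrOff (3 + 1) Lc) (k + 1)) n) (↥(pbox (towerTorus Lc (fine Lc (Mc B)) (n + 1))) × Fin (3 + 1)) ℝ)))) * ((I n) B)
        + (((L n) B) * (((H₁f n) B) v) - ((S n) B) * (fromRows (((Q₁₁f n) B) v) (0 : Matrix (NParam Lc (fine Lc (fine Lc (Mc B))) (fun k => (fun _ : ℕ => ctrOff (3 + 1) Lc) (k + 1)) n) (↥(pbox (towerTorus Lc (fine Lc (Mc B)) (n + 1))) × Fin (3 + 1)) ℝ))) * (-((((Γ n) B) * (((H₁f n) B) v') + ((I n) B) * (fromRows (((Q₁₁f n) B) v') (0 : Matrix (NParam Lc (fine Lc (fine Lc (Mc B))) (fun k => (fun _ : ℕ => ctrOff (3 + 1) Lc) (k + 1)) n) (↥(pbox (towerTorus Lc (fine Lc (Mc B)) (n + 1))) × Fin (3 + 1)) ℝ))) * ((I n) B) + ((Γ n) B) * (fromRows (((Q₁₁f n) B) v') (0 : Matrix (NParam Lc (fine Lc (fine Lc (Mc B))) (fun k => (fun _ : ℕ => ctrOff (3 + 1) Lc) (k + 1)) n) (↥(pbox (towerTorus Lc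 (fine Lc (Mc B)) (n + 1))) × Fin (3 + 1)) ℝ))ᵀ * ((S n) B))))
      - ((-((((L n) B) * (((H₁f n) B) v) - ((S n) B) * (fromRows (((Q₁₁f n) B) v) (0 : Matrix (NParam Lc (fine Lc (fine Lc (Mc B))) (fun k => (fun _ : ℕ => ctrOff (3 + 1) Lc) (k + 1)) n) (↥(pbox (towerTorus Lc (fine Lc (Mc B)) (n + 1))) × Fin (3 + 1)) ℝ))) * ((Γ n) B) - ((L n) B) * (fromRows (((Q₁₁f n) B) v) (0 : Matrix (NParam Lc (fine Lc (fine Lc (Mc B))) (fun k => (fun _ : ℕ => ctrOff (3 + 1) Lc) (k + 1)) n) (↥(pbox (towerTorus Lc (fine Lc (Mc B)) (n + 1))) × Fin (3 + 1)) ℝ))ᵀ * ((L n) B)) * (-(fromRows (((Q₁₁f n) B) v') (0 : Matrix (NParam Lc (fine Lc (fine Lc (Mc B))) (fun k => (fun _ : ℕ => ctrOff (3 + 1) Lc) (k + 1)) n) (↥(pbox (towerTorus Lc (fine Lc (Mc B)) (n + 1))) × Fin (3 + 1)) ℝ))ᵀ) + ((L n) B) * (fromRows (((Q₁₂f n) B)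 v v') (0 : Matrix (NParam Lc (fine Lc (fine Lc (Mc B))) (fun k => (fun _ : ℕ => ctrOff (3 + 1) Lc) (k + 1)) n) (↥(pbox (towerTorus Lc (fine Lc (Mc B)) (n + 1))) × Fin (3 + 1)) ℝ))ᵀ) * ((S n) B)
          + ((L n) B) * (-(fromRows (((Q₁₁f n) B) v) (0 : Matrix (NParam Lc (fine Lc (fine Lc (Mc B))) (fun k => (fun _ : ℕ => ctrOff (3 + 1) Lc) (k + 1)) n) (↥(pbox (towerTorus Lc (fine Lc (Mc B)) (n + 1))) × Fin (3 + 1)) ℝ))ᵀ) * ((((L n) B) * (((H₁f n) B) v') - ((S n) B) * (fromRows (((Q₁₁f n) B) v') (0 : Matrix (NParam Lc (fine Lc (fine Lc (Mc B))) (fun k => (fun _ : ℕ => ctrOff (3 + 1) Lc) (k + 1)) n) (↥(pbox (towerTorus Lc (fine Lc (Mc B)) (n + 1))) × Fin (3 + 1)) ℝ))) * ((I n) B) + ((L n) B) * (fromRows (((Q₁₁f n) B) v') (0 : Matrix (NParam Lc (fine Lc (fine Lc (Mc B))) (fun k => (fun _ : ℕ => ctrOff (3 + 1) Lc) (k + 1))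 n) (↥(pbox (towerTorus Lc (fine Lc (Mc B)) (n + 1))) × Fin (3 + 1)) ℝ))ᵀ * ((S n) B))))).toBlocks₁₁)
    -- #21's H-SIDE ROWS, FOR EVERY DIRECTION — DISPLAYED (R-FP-74∕75: `H₁f ∕ H₂f` are the TOTAL graded slots; their naming is the row's (C1) Hessian-table word): form parities, graded Ward rows
    (hH₂t : ∀ n : ℕ, ∀ B : ℕ, ∀ v, (((H₂f n) B) v v)ᵀ = ((H₂f n) B) v v)
    (a2 : ∀ n : ℕ, ∀ B : ℕ, ∀ v, ((H₂f n) B) v v * ((W₀ n) B) + (2 : ℝ) • (((H₁f n) B) v * ((W₁f n) B) v) + ((H₀ n) B) * ((W₂f n) B) v = -((2 : ℝ) • ((((𝔔₁f n) B) v)ᵀ * (0 : Matrix ((↥(pbox (Mc B)) × Fin (3 + 1))) (NParam Lc (fine Lc (Mc B)) (fun _ : ℕ => ctrOff (3 + 1) Lc) (n + 1)) ℝ))) + ((𝔔₀ n) B)ᵀ * ((Y₂f n) B) v)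
    -- THE H-SIDE AT THE TOTAL SLOT (SPEC-46 §C ∕ SPEC-47 §B): leaf-05's storey data DISPLAYED per depth and box (`Ma cf w κ ρH`, the storey DIRECTIONS `hb n B k` LINEAR in the
    -- top source with the top storey = the pinned nested column, (K1), the links, the PIN `hH₁f`); `hH₁l hH₁t a1` DISCHARGED by `TowerHSideRowsClosing`, `Y₁f := 0`
    (hLc2 : 2 ≤ Lc)
    (Ma : ∀ n : ℕ, ∀ B : ℕ, ℕ → (Fin (3 + 1) → ℕ)) (hMa : ∀ n : ℕ, ∀ B : ℕ, ∀ k i, towerTorus Lc (fine Lc (Mc B)) k i = Lc * ((Ma n) B) k i)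
    (cf : ∀ n : ℕ, ∀ B : ℕ, ℕ → (Fin (3 + 1) → Site (3 + 1) → Fin (3 + 1) → Site (3 + 1) → ℝ))
    (hcf : ∀ n : ℕ, ∀ B : ℕ, ∀ k κ' u μ y, Summable fun m : Site (3 + 1) => (cf n) B k μ (translate (((Ma n) B) k) y m) κ' u)
    (w κ : ∀ n : ℕ, ℕ → ℝ) (hκ : ∀ n : ℕ, ∀ k, k < n + 1 → (κ n) k = stepScale 3 Lc (n + 1 - (k + 1)) * ((box (3 + 1) Lc).card : ℝ) * (κ n) (k + 1))
    (hκn : ∀ n : ℕ, (κ n) (n + 1) = 1) (ρH : Fin (3 + 1) → ℤ)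
    (hb : ∀ n : ℕ, ∀ B : ℕ, (k : ℕ) → ((↥(pbox (Mc B)) × Fin (3 + 1)) → ℝ) → (↥(pbox (towerTorus Lc (fine Lc (Mc B)) k)) × Fin (3 + 1) → ℝ))
    (hbl : ∀ n : ℕ, ∀ B : ℕ, ∀ (k : ℕ) (r : ℝ) (x y : ((↥(pbox (Mc B)) × Fin (3 + 1)) → ℝ)), ((hb n) B) k (r • x + y) = r • ((hb n) B) k x + ((hb n) B) k y)
    (hbtop : ∀ n : ℕ, ∀ B : ℕ, ∀ v, ((hb n) B) (n + 1) v = ((hv n) B) v)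
    (K1 : ∀ n : ℕ, ∀ B : ℕ, ∀ v : ((↥(pbox (Mc B)) × Fin (3 + 1)) → ℝ), ∀ u : ↥(pbox (towerTorus Lc (fine Lc (Mc B)) (n + 1))) × Fin (3 + 1),
      (c n) * ((perF (towerTorus Lc (fine Lc (Mc B)) (n + 1)) (bhKStepAt 3 ρH Lc 0)).submatrix
          (fun b : ↥(pbox (towerTorus Lc (fine Lc (Mc B)) (n + 1))) × Fin (3 + 1) => ((b.1, Sum.inl b.2) : Idx (towerTorus Lc (fine Lc (Mc B)) (n + 1)) (Fib 3))) (fun b : ↥(pbox (towerTorus Lc (fine Lc (Mc B)) (n + 1))) × Fin (3 + 1) => ((b.1, Sum.inl b.2) : Idx (towerTorus Lc (fine Lc (Mc B)) (n + 1)) (Fib 3)))).mulVec (((hb n) B) (n + 1) v) u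
        = (w n) (n + 1) * ∑ ā : ↥(pbox (towerTorus Lc (fine Lc (Mc B)) (n + 1))) × Fin (3 + 1), ((hb n) B) (n + 1) v ā *
            ∑ μ : Fin (3 + 1), ∑' y : Site (3 + 1), (∑' m : Site (3 + 1), (cf n) B (n + 1) μ (translate (((Ma n) B) (n + 1)) y m) ā.2 (ā.1 : Site (3 + 1)))
              * symLinKerAt (toSite (ctrOff (3 + 1) Lc)) Lc μ y (u.2, (u.1 : Site (3 + 1))))
    (hlink : ∀ n : ℕ, ∀ B : ℕ, ∀ v : ((↥(pbox (Mc B)) × Fin (3 + 1)) → ℝ), ∀ k, k < n + 1 → ∀ a : ↥(pbox (towerTorus Lc (fine Lc (Mc B)) k)) × Fin (3 + 1),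
      (w n) k * (κ n) k * (∑ ā : ↥(pbox (towerTorus Lc (fine Lc (Mc B)) k)) × Fin (3 + 1), ((hb n) B) k v ā *
            ∑ μ : Fin (3 + 1), ∑' y : Site (3 + 1), (∑' m : Site (3 + 1), (cf n) B k μ (translate (((Ma n) B) k) y m) ā.2 (ā.1 : Site (3 + 1)))
              * symLinKerAt (toSite (ctrOff (3 + 1) Lc)) Lc μ y (a.2, (a.1 : Site (3 + 1))))
        = (w n) (k + 1) * (κ n) (k + 1) / (stepScale 3 Lc (n + 1 - (k + 1)) * (Lc : ℝ) ^ (3 + 1)) *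
          ∑ ā : ↥(pbox (towerTorus Lc (fine Lc (Mc B)) (k + 1))) × Fin (3 + 1), ((hb n) B) (k + 1) v ā *
            ∑' m : Site (3 + 1), (cf n) B (k + 1) a.2 (translate (towerTorus Lc (fine Lc (Mc B)) k) (a.1 : Site (3 + 1)) m) ā.2 (ā.1 : Site (3 + 1)))
    (hH₁f : ∀ n : ℕ, ∀ B : ℕ, ∀ v, ((H₁f n) B) v = (((-2 * (c n)) • ∑ b : ↥(pbox (towerTorus Lc (fine Lc (Mc B)) (n + 1))) × Fin (3 + 1), ((hb n) B) (n + 1) v b •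
          (perF (towerTorus Lc (fine Lc (Mc B)) (n + 1)) (dper (towerTorus Lc (fine Lc (Mc B)) (n + 1)) (wilsonA 3 b.2 (b.1 : Site (3 + 1))))).submatrix
            (fun b : ↥(pbox (towerTorus Lc (fine Lc (Mc B)) (n + 1))) × Fin (3 + 1) => ((b.1, Sum.inl b.2) : Idx (towerTorus Lc (fine Lc (Mc B)) (n + 1)) (Fib 3))) (fun b : ↥(pbox (towerTorus Lc (fine Lc (Mc B)) (n + 1))) × Fin (3 + 1) => ((b.1, Sum.inl b.2) : Idx (towerTorus Lc (fine Lc (Mc B)) (n + 1)) (Fib 3))))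
        + (w n) (n + 1) • ∑ ā : ↥(pbox (towerTorus Lc (fine Lc (Mc B)) (n + 1))) × Fin (3 + 1), ((hb n) B) (n + 1) v ā •
            (perF (towerTorus Lc (fine Lc (Mc B)) (n + 1)) (dper (towerTorus Lc (fine Lc (Mc B)) (n + 1)) (SLam N ((cf n) B (n + 1)) (fun μ y => symHessFFAt (toSite (ctrOff (3 + 1) Lc)) Lc μ y) ā.2 (ā.1 : Site (3 + 1))))).submatrix
              (fun b : ↥(pbox (towerTorus Lc (fine Lc (Mc B)) (n + 1))) × Fin (3 + 1) => ((b.1, Sum.inl b.2) : Idx (towerTorus Lc (fine Lc (Mc B)) (n + 1)) (Fib 3))) (fun b : ↥(pbox (towerTorus Lc (fine Lc (Mc B)) (n + 1))) × Fin (3 + 1) => ((b.1, Sum.inl b.2) : Idx (towerTorus Lc (fine Lc (Mc B)) (n + 1)) (Fib 3)))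
        + compSumSym Lc (onTowerFamily Lc (fine Lc (Mc B)) (fun k => (w n) k • ∑ ā : ↥(pbox (towerTorus Lc (fine Lc (Mc B)) k)) × Fin (3 + 1), ((hb n) B) k v ā •
            (perF (towerTorus Lc (fine Lc (Mc B)) k) (dper (towerTorus Lc (fine Lc (Mc B)) k) (SLam N ((cf n) B k) (fun μ y => symHessFFAt (toSite (ctrOff (3 + 1) Lc)) Lc μ y) ā.2 (ā.1 : Site (3 + 1))))).submatrix
              (fun b : ↥(pbox (towerTorus Lc (fine Lc (Mc B)) k)) × Fin (3 + 1) => ((b.1, Sum.inl b.2) : Idx (towerTorus Lc (fine Lc (Mc B)) k) (Fib 3))) (fun b : ↥(pbox (towerTorus Lc (fine Lc (Mc B)) k)) × Fin (3 + 1) => ((b.1, Sum.inl b.2) : Idx (towerTorus Lc (fine Lc (Mc B)) k) (Fib 3))))) (fine Lc (Mc B)) (fun i : ℕ => n + 1 - i) (fun _ : ℕ => ctrOff (3 + 1) Lc) (n + 1)))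
    -- the direction FAMILY (SPEC-46 §B′): one top one-shot source direction per label `(μ, y)`, per storey and per box (the row's transported directions, DISPLAYED)
    (dv : ∀ n : ℕ, ∀ B : ℕ, (Fin (3 + 1) × (Fin (3 + 1) → ℤ)) → ((↥(pbox (Mc B)) × Fin (3 + 1)) → ℝ))
    -- (S3-1) N — per box: the ONE-SHOT system of depth `n+2`, right inverse and LEG over the box-free chart kernel `A_N` under the torus rules (DISPLAYED);
    -- (P2‴)'s lattice letters of `A_N`: decay + blocking-`Lc^(n+2)` covariance (#42a VERBATIM)
    {XN : ∀ n : ℕ, ∀ B : ℕ, Matrix ((↥(pbox (towerTorus Lc (fine Lc (Mc B)) (n + 1))) × Fin (3 + 1)) ⊕ ((↥(pbox (Mc B)) × Fin (3 + 1)) ⊕ (NParam Lc (fine Lc (Mc B)) (fun _ : ℕ => ctrOff (3 + 1) Lc) (n + 1)))) ((↥(pbox (towerTorus Lc (fine Lc (Mc B)) (n + 1))) × Fin (3 + 1)) ⊕ ((↥(pbox (Mc B)) × Fin (3 + 1)) ⊕ (NParam Lc (fine Lc (Mc B)) (fun _ : ℕ => ctrOff (3 + 1) Lc) (n + 1))))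 ℝ}
    (hXN : ∀ n : ℕ, ∀ B : ℕ, kkt ((H₀ n) B) (fromRows ((𝔔₀ n) B) ((P n) B)) * (XN n) B = 1)
    (ρN : ∀ n : ℕ, Fin (3 + 1) → ℤ)
    (LNc : ∀ n : ℕ, ℕ)
    (fN : ∀ n : ℕ, ∀ B : ℕ, (↥(pbox (Mc B)) × Fin (3 + 1)) → Idx (towerTorus Lc (fine Lc (Mc B)) (n + 1)) (Fib 3))
    (hfN : ∀ n : ℕ, ∀ B : ℕ, Function.Injective ((fN n) B))
    (hmN : ∀ n : ℕ, ∀ B : ℕ, ∀ a : (↥(pbox (Mc B)) × Fin (3 + 1)), ∃ m : Fin (3 + 1), ((fN n) B a).2 = Sum.inr m)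
    (hcN : ∀ n : ℕ, ∀ B : ℕ, ∀ (s : ↥(pbox (towerTorus Lc (fine Lc (Mc B)) (n + 1)))) (m : Fin (3 + 1)), ((s, Sum.inr m) : Idx (towerTorus Lc (fine Lc (Mc B)) (n + 1)) (Fib 3)) ∈ Set.range ((fN n) B) ↔ Torus.proj (LNc n) (s : Site (3 + 1)) = 0)
    (hEAN : ∀ n : ℕ, ∀ B : ℕ, perF (towerTorus Lc (fine Lc (Mc B)) (n + 1)) (axEc (ρN n) (LNc n)) * perF (towerTorus Lc (fine Lc (Mc B)) (n + 1)) (AN (Roots.ctr Lc) (n + 1)) = perF (towerTorus Lc (fine Lc (Mc B)) (n + 1)) (AN (Roots.ctr Lc) (n + 1)))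
    (hAEN : ∀ n : ℕ, ∀ B : ℕ, perF (towerTorus Lc (fine Lc (Mc B)) (n + 1)) (AN (Roots.ctr Lc) (n + 1)) * perF (towerTorus Lc (fine Lc (Mc B)) (n + 1)) (axEc (ρN n) (LNc n)) = perF (towerTorus Lc (fine Lc (Mc B)) (n + 1)) (AN (Roots.ctr Lc) (n + 1)))
    (hLN : ∀ n : ℕ, ∀ B : ℕ, ((XN n) B).submatrix (Sum.map id Sum.inl) (Sum.map id Sum.inl) = fromBlocks
      (Matrix.of fun (b b' : (↥(pbox (towerTorus Lc (fine Lc (Mc B)) (n + 1))) × Fin (3 + 1))) =>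
        axEc (ρN n) (LNc n) (b.1 : Site (3 + 1)) (b.1 : Site (3 + 1)) (Sum.inl b.2) (Sum.inl b.2)
          * (axEc (ρN n) (LNc n) (b'.1 : Site (3 + 1)) (b'.1 : Site (3 + 1)) (Sum.inl b'.2) (Sum.inl b'.2) * perF (towerTorus Lc (fine Lc (Mc B)) (n + 1)) (AN (Roots.ctr Lc) (n + 1)) (b.1, Sum.inl b.2) (b'.1, Sum.inl b'.2)))
      (Matrix.of fun (b : (↥(pbox (towerTorus Lc (fine Lc (Mc B)) (n + 1))) × Fin (3 + 1))) (a : (↥(pbox (Mc B)) × Fin (3 + 1))) =>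
        axEc (ρN n) (LNc n) (b.1 : Site (3 + 1)) (b.1 : Site (3 + 1)) (Sum.inl b.2) (Sum.inl b.2) * perF (towerTorus Lc (fine Lc (Mc B)) (n + 1)) (AN (Roots.ctr Lc) (n + 1)) (b.1, Sum.inl b.2) (((fN n) B) a))
      (-Matrix.of fun (a : (↥(pbox (Mc B)) × Fin (3 + 1))) (b : (↥(pbox (towerTorus Lc (fine Lc (Mc B)) (n + 1))) × Fin (3 + 1))) =>
        axEc (ρN n) (LNc n) (b.1 : Site (3 + 1)) (b.1 : Site (3 + 1)) (Sum.inl b.2) (Sum.inl b.2) * perF (towerTorus Lc (fine Lc (Mc B)) (n + 1)) (AN (Roots.ctr Lc) (n + 1)) (((fN n) B) a) (b.1, Sum.inl b.2))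
      (-((perF (towerTorus Lc (fine Lc (Mc B)) (n + 1)) (AN (Roots.ctr Lc) (n + 1))).submatrix ((fN n) B) ((fN n) B))))
    -- (S3-2) N — FAMILY FORM (SPEC-46 §B′): an2's jets `VN ∕ WN (n+1)` are VERTEX FAMILIES (both legs at `NN n • y`); PER BOX their periodisations carry the parities
    -- and ARE the door's transported `N` jets along the direction FAMILY `dv n B (μ, y)`; the named law reads the instances `(μ,0)`, `(ν,z)`, `(μ,0;ν,z)`
    {NN : ℕ → ℕ} {CvN CwN δN : ℕ → ℝ}
    (hVN : ∀ n : ℕ, VertexFamily (VN (Roots.ctr Lc) Pn (n + 1)) (NN n) (CvN n) (δN n))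
    (hWN : ∀ n : ℕ, VertexFamily₂ (WN (Roots.ctr Lc) Pn (n + 1)) (NN n) (CwN n) (δN n))
    (hδN : ∀ n : ℕ, 0 < δN n)
    (hVNm : ∀ (n : ℕ) (μ : Fin (3 + 1)) (y : Fin (3 + 1) → ℤ), ∀ B : ℕ, ∀ a a' : (↥(pbox (Mc B)) × Fin (3 + 1)), (perF (towerTorus Lc (fine Lc (Mc B)) (n + 1)) (dper (towerTorus Lc (fine Lc (Mc B)) (n + 1)) ((VN (Roots.ctr Lc) Pn (n + 1)) μ y))) (((fN n) B) a) (((fN n) B) a') = 0)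
    (hVNt : ∀ (n : ℕ) (μ : Fin (3 + 1)) (y : Fin (3 + 1) → ℤ), ∀ B : ℕ, ∀ (b : (↥(pbox (towerTorus Lc (fine Lc (Mc B)) (n + 1))) × Fin (3 + 1))) (a : (↥(pbox (Mc B)) × Fin (3 + 1))), (perF (towerTorus Lc (fine Lc (Mc B)) (n + 1)) (dper (towerTorus Lc (fine Lc (Mc B)) (n + 1)) ((VN (Roots.ctr Lc) Pn (n + 1)) μ y))) (b.1, Sum.inl b.2) (((fN n) B) a) = (perF (towerTorus Lc (fine Lc (Mc B)) (n + 1)) (dper (towerTorus Lc (fine Lc (Mc B)) (n + 1)) ((VN (Roots.ctr Lc) Pn (n + 1)) μ y))) (((fN n) B) a) (b.1, Sum.inl b.2))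
    (hWNm : ∀ (n : ℕ) (μ : Fin (3 + 1)) (y : Fin (3 + 1) → ℤ) (ν : Fin (3 + 1)) (y' : Fin (3 + 1) → ℤ), ∀ B : ℕ, ∀ a a' : (↥(pbox (Mc B)) × Fin (3 + 1)), (perF (towerTorus Lc (fine Lc (Mc B)) (n + 1)) (dper (towerTorus Lc (fine Lc (Mc B)) (n + 1)) ((WN (Roots.ctr Lc) Pn (n + 1)) μ y ν y'))) (((fN n) B) a) (((fN n) B) a') = 0)
    (hWNt : ∀ (n : ℕ) (μ : Fin (3 + 1)) (y : Fin (3 + 1) → ℤ) (ν : Fin (3 + 1)) (y' : Fin (3 + 1) → ℤ), ∀ B : ℕ, ∀ (b : (↥(pbox (towerTorus Lc (fine Lc (Mc B)) (n + 1))) × Fin (3 + 1))) (a : (↥(pbox (Mc B)) × Fin (3 + 1))), (perF (towerTorus Lc (fine Lc (Mc B)) (n + 1)) (dper (towerTorus Lc (fine Lc (Mc B)) (n + 1)) ((WN (Roots.ctr Lc) Pn (n + 1)) μ y ν y'))) (b.1, Sum.inl b.2) (((fN n) B) a) = -(perF (towerTorus Lc (fine Lc (Mc B)) (n + 1)) (dper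 (towerTorus Lc (fine Lc (Mc B)) (n + 1)) ((WN (Roots.ctr Lc) Pn (n + 1)) μ y ν y'))) (((fN n) B) a) (b.1, Sum.inl b.2))
    (hHN₁ : ∀ (n : ℕ) (μ : Fin (3 + 1)) (y : Fin (3 + 1) → ℤ), ∀ B : ℕ, (H'₁f n) B ((dv n) B (μ, y)) = (perF (towerTorus Lc (fine Lc (Mc B)) (n + 1)) (dper (towerTorus Lc (fine Lc (Mc B)) (n + 1)) ((VN (Roots.ctr Lc) Pn (n + 1)) μ y))).submatrix (fun b : (↥(pbox (towerTorus Lc (fine Lc (Mc B)) (n + 1))) × Fin (3 + 1)) => ((b.1, Sum.inl b.2) : Idx (towerTorus Lc (fine Lc (Mc B)) (n + 1)) (Fib 3))) (fun b : (↥(pbox (towerTorus Lc (fine Lc (Mc B)) (n + 1))) × Fin (3 + 1)) => ((b.1, Sum.inl b.2) : Idx (towerTorus Lc (fine Lc (Mc B)) (n + 1)) (Fib 3))))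
    (hQN₁ : ∀ (n : ℕ) (μ : Fin (3 + 1)) (y : Fin (3 + 1) → ℤ), ∀ B : ℕ, (𝔔'₁f n) B ((dv n) B (μ, y)) = (perF (towerTorus Lc (fine Lc (Mc B)) (n + 1)) (dper (towerTorus Lc (fine Lc (Mc B)) (n + 1)) ((VN (Roots.ctr Lc) Pn (n + 1)) μ y))).submatrix ((fN n) B) (fun b : (↥(pbox (towerTorus Lc (fine Lc (Mc B)) (n + 1))) × Fin (3 + 1)) => ((b.1, Sum.inl b.2) : Idx (towerTorus Lc (fine Lc (Mc B)) (n + 1)) (Fib 3))))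
    (hHN₂ : ∀ (n : ℕ) (μ : Fin (3 + 1)) (y : Fin (3 + 1) → ℤ) (ν : Fin (3 + 1)) (y' : Fin (3 + 1) → ℤ), ∀ B : ℕ, (1 / 2 : ℝ) • ((H'₂f n) B ((dv n) B (μ, y)) ((dv n) B (ν, y')) + (H'₂f n) B ((dv n) B (ν, y')) ((dv n) B (μ, y))) = (perF (towerTorus Lc (fine Lc (Mc B)) (n + 1)) (dper (towerTorus Lc (fine Lc (Mc B)) (n + 1)) ((WN (Roots.ctr Lc) Pn (n + 1)) μ y ν y'))).submatrix (fun b : (↥(pbox (towerTorus Lc (fine Lc (Mc B)) (n + 1))) × Fin (3 + 1)) => ((b.1, Sum.inl b.2) : Idx (towerTorus Lc (fine Lc (Mc B)) (n + 1)) (Fib 3))) (fun b : (↥(pbox (towerTorus Lc (fine Lc (Mc B)) (n + 1))) × Fin (3 + 1)) => ((b.1, Sum.inl b.2) : Idx (towerTorus Lc (fine Lc (Mc B)) (n + 1)) (Fib 3))))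
    (hQN₂ : ∀ (n : ℕ) (μ : Fin (3 + 1)) (y : Fin (3 + 1) → ℤ) (ν : Fin (3 + 1)) (y' : Fin (3 + 1) → ℤ), ∀ B : ℕ, (1 / 2 : ℝ) • ((𝔔'₂f n) B ((dv n) B (μ, y)) ((dv n) B (ν, y')) + (𝔔'₂f n) B ((dv n) B (ν, y')) ((dv n) B (μ, y))) = (perF (towerTorus Lc (fine Lc (Mc B)) (n + 1)) (dper (towerTorus Lc (fine Lc (Mc B)) (n + 1)) ((WN (Roots.ctr Lc) Pn (n + 1)) μ y ν y'))).submatrix ((fN n) B) (fun b : (↥(pbox (towerTorus Lc (fine Lc (Mc B)) (n + 1))) × Fin (3 + 1)) => ((b.1, Sum.inl b.2) : Idx (towerTorus Lc (fine Lc (Mc B)) (n + 1)) (Fib 3))))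
    -- (S3-1) F — per box: the ONE-SHOT system of the tower below (depth `n+1`, same finest torus), right inverse and LEG over `A_F` (DISPLAYED);
    -- (P2‴)'s lattice letters of `A_F`: decay + blocking-`Lc^(n+1)` covariance (#42a VERBATIM)
    {XF : ∀ n : ℕ, ∀ B : ℕ, Matrix ((↥(pbox (towerTorus Lc (fine Lc (Mc B)) (n + 1))) × Fin (3 + 1)) ⊕ ((↥(pbox (fine Lc (Mc B))) × Fin (3 + 1)) ⊕ (NParam Lc (fine Lc (fine Lc (Mc B))) (fun k => (fun _ : ℕ => ctrOff (3 + 1) Lc) (k + 1)) n))) ((↥(pbox (towerTorus Lc (fine Lc (Mc B)) (n + 1))) × Fin (3 + 1)) ⊕ ((↥(pbox (fine Lc (Mc B))) × Fin (3 + 1)) ⊕ (NParam Lc (fine Lc (fine Lc (Mc B))) (fun k => (fun _ : ℕ => ctrOff (3 + 1) Lc) (k + 1)) n))) ℝ}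
    (hXF : ∀ n : ℕ, ∀ B : ℕ, kkt ((H₀ n) B) (fromRows ((Q₁₀ n) B) ((τ₁ n) B)) * (XF n) B = 1)
    (ρF : ∀ n : ℕ, Fin (3 + 1) → ℤ)
    (LFc : ∀ n : ℕ, ℕ)
    (fF : ∀ n : ℕ, ∀ B : ℕ, (↥(pbox (fine Lc (Mc B))) × Fin (3 + 1)) → Idx (towerTorus Lc (fine Lc (Mc B)) (n + 1)) (Fib 3))
    (hfF : ∀ n : ℕ, ∀ B : ℕ, Function.Injective ((fF n) B))
    (hmF : ∀ n : ℕ, ∀ B : ℕ, ∀ a : (↥(pbox (fine Lc (Mc B))) × Fin (3 + 1)), ∃ m : Fin (3 + 1), ((fF n) B a).2 = Sum.inr m)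
    (hcF : ∀ n : ℕ, ∀ B : ℕ, ∀ (s : ↥(pbox (towerTorus Lc (fine Lc (Mc B)) (n + 1)))) (m : Fin (3 + 1)), ((s, Sum.inr m) : Idx (towerTorus Lc (fine Lc (Mc B)) (n + 1)) (Fib 3)) ∈ Set.range ((fF n) B) ↔ Torus.proj (LFc n) (s : Site (3 + 1)) = 0)
    {CAF αF : ∀ n : ℕ, ℝ}
    (hAF : ∀ n : ℕ, Decays (AF (n + 1)) (CAF n) (αF n))
    (hαF : ∀ n : ℕ, 0 < (αF n))
    (hAFsh : ∀ n : ℕ, ∀ t : Fin (3 + 1) → ℤ, shiftK (((Lc ^ (n + 1) : ℕ) : ℤ) • t) (AF (n + 1)) = (AF (n + 1)))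
    (hEAF : ∀ n : ℕ, ∀ B : ℕ, perF (towerTorus Lc (fine Lc (Mc B)) (n + 1)) (axEc (ρF n) (LFc n)) * perF (towerTorus Lc (fine Lc (Mc B)) (n + 1)) (AF (n + 1)) = perF (towerTorus Lc (fine Lc (Mc B)) (n + 1)) (AF (n + 1)))
    (hAEF : ∀ n : ℕ, ∀ B : ℕ, perF (towerTorus Lc (fine Lc (Mc B)) (n + 1)) (AF (n + 1)) * perF (towerTorus Lc (fine Lc (Mc B)) (n + 1)) (axEc (ρF n) (LFc n)) = perF (towerTorus Lc (fine Lc (Mc B)) (n + 1)) (AF (n + 1)))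
    (hLF : ∀ n : ℕ, ∀ B : ℕ, ((XF n) B).submatrix (Sum.map id Sum.inl) (Sum.map id Sum.inl) = fromBlocks
      (Matrix.of fun (b b' : (↥(pbox (towerTorus Lc (fine Lc (Mc B)) (n + 1))) × Fin (3 + 1))) =>
        axEc (ρF n) (LFc n) (b.1 : Site (3 + 1)) (b.1 : Site (3 + 1)) (Sum.inl b.2) (Sum.inl b.2)
          * (axEc (ρF n) (LFc n) (b'.1 : Site (3 + 1)) (b'.1 : Site (3 + 1)) (Sum.inl b'.2) (Sum.inl b'.2) * perF (towerTorus Lc (fine Lc (Mc B)) (n + 1)) (AF (n + 1)) (b.1, Sum.inl b.2) (b'.1, Sum.inl b'.2)))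
      (Matrix.of fun (b : (↥(pbox (towerTorus Lc (fine Lc (Mc B)) (n + 1))) × Fin (3 + 1))) (a : (↥(pbox (fine Lc (Mc B))) × Fin (3 + 1))) =>
        axEc (ρF n) (LFc n) (b.1 : Site (3 + 1)) (b.1 : Site (3 + 1)) (Sum.inl b.2) (Sum.inl b.2) * perF (towerTorus Lc (fine Lc (Mc B)) (n + 1)) (AF (n + 1)) (b.1, Sum.inl b.2) (((fF n) B) a))
      (-Matrix.of fun (a : (↥(pbox (fine Lc (Mc B))) × Fin (3 + 1))) (b : (↥(pbox (towerTorus Lc (fine Lc (Mc B)) (n + 1))) × Fin (3 + 1))) =>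
        axEc (ρF n) (LFc n) (b.1 : Site (3 + 1)) (b.1 : Site (3 + 1)) (Sum.inl b.2) (Sum.inl b.2) * perF (towerTorus Lc (fine Lc (Mc B)) (n + 1)) (AF (n + 1)) (((fF n) B) a) (b.1, Sum.inl b.2))
      (-((perF (towerTorus Lc (fine Lc (Mc B)) (n + 1)) (AF (n + 1))).submatrix ((fF n) B) ((fF n) B))))
    -- (S3-2) F — FAMILY FORM: the lattice jets `𝒱F ∕ 𝒲F (n+1)` of the tower below are vertex families at scale `NF n`; PER BOX their periodisations carry the
    -- parities and ARE the door's fine jets `H₁f ∕ Q₁₁f` (first order) and the symmetrised `H₂f ∕ Q₁₂f` (second order) along the family `dv n B (μ, y)`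
    {NF : ℕ → ℕ} {CvF CwF δF : ℕ → ℝ}
    (hVF : ∀ n : ℕ, VertexFamily (𝒱F (n + 1)) (NF n) (CvF n) (δF n))
    (hWF : ∀ n : ℕ, VertexFamily₂ (𝒲F (n + 1)) (NF n) (CwF n) (δF n))
    (hδF : ∀ n : ℕ, 0 < δF n)
    (hVFm : ∀ (n : ℕ) (μ : Fin (3 + 1)) (y : Fin (3 + 1) → ℤ), ∀ B : ℕ, ∀ a a' : (↥(pbox (fine Lc (Mc B))) × Fin (3 + 1)), (perF (towerTorus Lc (fine Lc (Mc B)) (n + 1)) (dper (towerTorus Lc (fine Lc (Mc B)) (n + 1)) ((𝒱F (n + 1)) μ y))) (((fF n) B) a) (((fF n) B) a') = 0)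
    (hVFt : ∀ (n : ℕ) (μ : Fin (3 + 1)) (y : Fin (3 + 1) → ℤ), ∀ B : ℕ, ∀ (b : (↥(pbox (towerTorus Lc (fine Lc (Mc B)) (n + 1))) × Fin (3 + 1))) (a : (↥(pbox (fine Lc (Mc B))) × Fin (3 + 1))), (perF (towerTorus Lc (fine Lc (Mc B)) (n + 1)) (dper (towerTorus Lc (fine Lc (Mc B)) (n + 1)) ((𝒱F (n + 1)) μ y))) (b.1, Sum.inl b.2) (((fF n) B) a) = (perF (towerTorus Lc (fine Lc (Mc B)) (n + 1)) (dper (towerTorus Lc (fine Lc (Mc B)) (n + 1)) ((𝒱F (n + 1)) μ y))) (((fF n) B) a) (b.1, Sum.inl b.2))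
    (hWFm : ∀ (n : ℕ) (μ : Fin (3 + 1)) (y : Fin (3 + 1) → ℤ) (ν : Fin (3 + 1)) (y' : Fin (3 + 1) → ℤ), ∀ B : ℕ, ∀ a a' : (↥(pbox (fine Lc (Mc B))) × Fin (3 + 1)), (perF (towerTorus Lc (fine Lc (Mc B)) (n + 1)) (dper (towerTorus Lc (fine Lc (Mc B)) (n + 1)) ((𝒲F (n + 1)) μ y ν y'))) (((fF n) B) a) (((fF n) B) a') = 0)
    (hWFt : ∀ (n : ℕ) (μ : Fin (3 + 1)) (y : Fin (3 + 1) → ℤ) (ν : Fin (3 + 1)) (y' : Fin (3 + 1) → ℤ), ∀ B : ℕ, ∀ (b : (↥(pbox (towerTorus Lc (fine Lc (Mc B)) (n + 1))) × Fin (3 + 1))) (a : (↥(pbox (fine Lc (Mc B))) × Fin (3 + 1))), (perF (towerTorus Lc (fine Lc (Mc B)) (n + 1)) (dper (towerTorus Lc (fine Lc (Mc B)) (n + 1)) ((𝒲F (n + 1)) μ y ν y'))) (b.1, Sum.inl b.2) (((fF n) B) a) = -(perF (towerTorus Lc (fine Lc (Mc B)) (n + 1)) (dper (towerTorus Lc (fine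 Lc (Mc B)) (n + 1)) ((𝒲F (n + 1)) μ y ν y'))) (((fF n) B) a) (b.1, Sum.inl b.2))
    (hHF₁ : ∀ (n : ℕ) (μ : Fin (3 + 1)) (y : Fin (3 + 1) → ℤ), ∀ B : ℕ, (H₁f n) B ((dv n) B (μ, y)) = (perF (towerTorus Lc (fine Lc (Mc B)) (n + 1)) (dper (towerTorus Lc (fine Lc (Mc B)) (n + 1)) ((𝒱F (n + 1)) μ y))).submatrix (fun b : (↥(pbox (towerTorus Lc (fine Lc (Mc B)) (n + 1))) × Fin (3 + 1)) => ((b.1, Sum.inl b.2) : Idx (towerTorus Lc (fine Lc (Mc B)) (n + 1)) (Fib 3))) (fun b : (↥(pbox (towerTorus Lc (fine Lc (Mc B)) (n + 1))) × Fin (3 + 1)) => ((b.1, Sum.inl b.2) : Idx (towerTorus Lc (fine Lc (Mc B)) (n + 1)) (Fib 3))))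
    (hQF₁ : ∀ (n : ℕ) (μ : Fin (3 + 1)) (y : Fin (3 + 1) → ℤ), ∀ B : ℕ, (Q₁₁f n) B ((dv n) B (μ, y)) = (perF (towerTorus Lc (fine Lc (Mc B)) (n + 1)) (dper (towerTorus Lc (fine Lc (Mc B)) (n + 1)) ((𝒱F (n + 1)) μ y))).submatrix ((fF n) B) (fun b : (↥(pbox (towerTorus Lc (fine Lc (Mc B)) (n + 1))) × Fin (3 + 1)) => ((b.1, Sum.inl b.2) : Idx (towerTorus Lc (fine Lc (Mc B)) (n + 1)) (Fib 3))))
    (hHF₂ : ∀ (n : ℕ) (μ : Fin (3 + 1)) (y : Fin (3 + 1) → ℤ) (ν : Fin (3 + 1)) (y' : Fin (3 + 1) → ℤ), ∀ B : ℕ, (1 / 2 : ℝ) • ((H₂f n) B ((dv n) B (μ, y)) ((dv n) B (ν, y')) + (H₂f n) B ((dv n) B (ν, y')) ((dv n) B (μ, y))) = (perF (towerTorus Lc (fine Lc (Mc B)) (n + 1)) (dper (towerTorus Lc (fine Lc (Mc B)) (n + 1)) ((𝒲F (n + 1)) μ y ν y'))).submatrix (fun b : (↥(pbox (towerTorus Lc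 (fine Lc (Mc B)) (n + 1))) × Fin (3 + 1)) => ((b.1, Sum.inl b.2) : Idx (towerTorus Lc (fine Lc (Mc B)) (n + 1)) (Fib 3))) (fun b : (↥(pbox (towerTorus Lc (fine Lc (Mc B)) (n + 1))) × Fin (3 + 1)) => ((b.1, Sum.inl b.2) : Idx (towerTorus Lc (fine Lc (Mc B)) (n + 1)) (Fib 3))))
    (hQF₂ : ∀ (n : ℕ) (μ : Fin (3 + 1)) (y : Fin (3 + 1) → ℤ) (ν : Fin (3 + 1)) (y' : Fin (3 + 1) → ℤ), ∀ B : ℕ, (1 / 2 : ℝ) • ((Q₁₂f n) B ((dv n) B (μ, y)) ((dv n) B (ν, y')) + (Q₁₂f n) B ((dv n) B (ν, y')) ((dv n) B (μ, y))) = (perF (towerTorus Lc (fine Lc (Mc B)) (n + 1)) (dper (towerTorus Lc (fine Lc (Mc B)) (n + 1)) ((𝒲F (n + 1)) μ y ν y'))).submatrix ((fF n) B) (fun b : (↥(pbox (towerTorus Lc (fine Lc (Mc B)) (n + 1))) × Fin (3 + 1)) => ((b.1, Sum.inl b.2) : Idx (towerTorus Lc (fine Lc (Mc B)) (n + 1))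 (Fib 3))))
    -- `a ↦ (pμ′ B a, inr (mμ′ B a))`, the H-blocks CARRYING THE UNIT `∏_{i<n+1} wVH 3 Lc (lev i)` (DISPLAYED — an2's (C1) naming item, SPEC-45 §C ∕ J-RISK-4 ∕ J-NOTE-6)
    -- (S3-2) G — FAMILY FORM: the lattice jets `𝒱G ∕ 𝒲G (n+1)` of the TOP STEP are vertex families at scale `NG n`; PER BOX their periodisations on `fine Lc (Mc B)`
    -- carry the parities and ARE the door's `G` jets `Gw₁f ∕ Q₂₁f`, `Gw₂f ∕ Q₂₂f` (with the tower weight `∏ wVH`) at the slots, along the family `dv n B (μ, y)`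
    {NG : ℕ → ℕ} {CvG CwG δG : ℕ → ℝ}
    (hVG : ∀ n : ℕ, VertexFamily (𝒱G (n + 1)) (NG n) (CvG n) (δG n))
    (hWG : ∀ n : ℕ, VertexFamily₂ (𝒲G (n + 1)) (NG n) (CwG n) (δG n))
    (hδG : ∀ n : ℕ, 0 < δG n)
    (hVGm : ∀ (n : ℕ) (μ : Fin (3 + 1)) (y : Fin (3 + 1) → ℤ), ∀ B : ℕ, ∀ a a' : (↥(pbox (Mc B)) × Fin (3 + 1)), (perF (fine Lc (Mc B)) (dper (fine Lc (Mc B)) ((𝒱G (n + 1)) μ y))) (((coarsePt (Mc B) Lc a.1, Sum.inr (a.2)) : Idx (fine Lc (Mc B)) (Fib 3))) (((coarsePt (Mc B) Lc a'.1, Sum.inr (a'.2)) : Idx (fine Lc (Mc B)) (Fib 3))) = 0)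
    (hVGt : ∀ (n : ℕ) (μ : Fin (3 + 1)) (y : Fin (3 + 1) → ℤ), ∀ B : ℕ, ∀ (b : (↥(pbox (fine Lc (Mc B))) × Fin (3 + 1))) (a : (↥(pbox (Mc B)) × Fin (3 + 1))), (perF (fine Lc (Mc B)) (dper (fine Lc (Mc B)) ((𝒱G (n + 1)) μ y))) (b.1, Sum.inl b.2) (((coarsePt (Mc B) Lc a.1, Sum.inr (a.2)) : Idx (fine Lc (Mc B)) (Fib 3))) = (perF (fine Lc (Mc B)) (dper (fine Lc (Mc B)) ((𝒱G (n + 1)) μ y))) (((coarsePt (Mc B) Lc a.1, Sum.inr (a.2)) : Idx (fine Lc (Mc B)) (Fib 3))) (b.1, Sum.inl b.2))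
    (hWGm : ∀ (n : ℕ) (μ : Fin (3 + 1)) (y : Fin (3 + 1) → ℤ) (ν : Fin (3 + 1)) (y' : Fin (3 + 1) → ℤ), ∀ B : ℕ, ∀ a a' : (↥(pbox (Mc B)) × Fin (3 + 1)), (perF (fine Lc (Mc B)) (dper (fine Lc (Mc B)) ((𝒲G (n + 1)) μ y ν y'))) (((coarsePt (Mc B) Lc a.1, Sum.inr (a.2)) : Idx (fine Lc (Mc B)) (Fib 3))) (((coarsePt (Mc B) Lc a'.1, Sum.inr (a'.2)) : Idx (fine Lc (Mc B)) (Fib 3))) = 0)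
    (hWGt : ∀ (n : ℕ) (μ : Fin (3 + 1)) (y : Fin (3 + 1) → ℤ) (ν : Fin (3 + 1)) (y' : Fin (3 + 1) → ℤ), ∀ B : ℕ, ∀ (b : (↥(pbox (fine Lc (Mc B))) × Fin (3 + 1))) (a : (↥(pbox (Mc B)) × Fin (3 + 1))), (perF (fine Lc (Mc B)) (dper (fine Lc (Mc B)) ((𝒲G (n + 1)) μ y ν y'))) (b.1, Sum.inl b.2) (((coarsePt (Mc B) Lc a.1, Sum.inr (a.2)) : Idx (fine Lc (Mc B)) (Fib 3))) = -(perF (fine Lc (Mc B)) (dper (fine Lc (Mc B)) ((𝒲G (n + 1)) μ y ν y'))) (((coarsePt (Mc B) Lc a.1, Sum.inr (a.2)) : Idx (fine Lc (Mc B)) (Fib 3))) (b.1, Sum.inl b.2))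
    (hHG₁ : ∀ (n : ℕ) (μ : Fin (3 + 1)) (y : Fin (3 + 1) → ℤ), ∀ B : ℕ, (∏ i ∈ range (n + 1), wVH 3 Lc ((n + 1 - i))) • (Gw₁f n) B ((dv n) B (μ, y)) = (perF (fine Lc (Mc B)) (dper (fine Lc (Mc B)) ((𝒱G (n + 1)) μ y))).submatrix (fun b : (↥(pbox (fine Lc (Mc B))) × Fin (3 + 1)) => ((b.1, Sum.inl b.2) : Idx (fine Lc (Mc B)) (Fib 3))) (fun b : (↥(pbox (fine Lc (Mc B))) × Fin (3 + 1)) => ((b.1, Sum.inl b.2) : Idx (fine Lc (Mc B)) (Fib 3))))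
    (hQG₁ : ∀ (n : ℕ) (μ : Fin (3 + 1)) (y : Fin (3 + 1) → ℤ), ∀ B : ℕ, (Q₂₁f n) B ((dv n) B (μ, y)) = (perF (fine Lc (Mc B)) (dper (fine Lc (Mc B)) ((𝒱G (n + 1)) μ y))).submatrix (fun a : (↥(pbox (Mc B)) × Fin (3 + 1)) => (((coarsePt (Mc B) Lc a.1, Sum.inr (a.2)) : Idx (fine Lc (Mc B)) (Fib 3)))) (fun b : (↥(pbox (fine Lc (Mc B))) × Fin (3 + 1)) => ((b.1, Sum.inl b.2) : Idx (fine Lc (Mc B)) (Fib 3))))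
    (hHG₂ : ∀ (n : ℕ) (μ : Fin (3 + 1)) (y : Fin (3 + 1) → ℤ) (ν : Fin (3 + 1)) (y' : Fin (3 + 1) → ℤ), ∀ B : ℕ, (∏ i ∈ range (n + 1), wVH 3 Lc ((n + 1 - i))) • ((1 / 2 : ℝ) • ((Gw₂f n) B ((dv n) B (μ, y)) ((dv n) B (ν, y')) + (Gw₂f n) B ((dv n) B (ν, y')) ((dv n) B (μ, y)))) = (perF (fine Lc (Mc B)) (dper (fine Lc (Mc B)) ((𝒲G (n + 1)) μ y ν y'))).submatrix (fun b : (↥(pbox (fine Lc (Mc B))) × Fin (3 + 1)) => ((b.1, Sum.inl b.2) : Idx (fine Lc (Mc B)) (Fib 3))) (fun b : (↥(pbox (fine Lc (Mc B))) × Fin (3 + 1)) => ((b.1, Sum.inl b.2) : Idx (fine Lc (Mc B)) (Fib 3))))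
    (hQG₂ : ∀ (n : ℕ) (μ : Fin (3 + 1)) (y : Fin (3 + 1) → ℤ) (ν : Fin (3 + 1)) (y' : Fin (3 + 1) → ℤ), ∀ B : ℕ, (1 / 2 : ℝ) • ((Q₂₂f n) B ((dv n) B (μ, y)) ((dv n) B (ν, y')) + (Q₂₂f n) B ((dv n) B (ν, y')) ((dv n) B (μ, y))) = (perF (fine Lc (Mc B)) (dper (fine Lc (Mc B)) ((𝒲G (n + 1)) μ y ν y'))).submatrix (fun a : (↥(pbox (Mc B)) × Fin (3 + 1)) => (((coarsePt (Mc B) Lc a.1, Sum.inr (a.2)) : Idx (fine Lc (Mc B)) (Fib 3)))) (fun b : (↥(pbox (fine Lc (Mc B))) × Fin (3 + 1)) => ((b.1, Sum.inl b.2) : Idx (fine Lc (Mc B)) (Fib 3))))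
    -- END-Comp's other rows, VERBATIM (the anchor storey, the TRANSPORT clause, the top-step identification at `GcombSh Lc j`, (T0)(T1))
    (hF₁ : ∀ (μ ν : Fin 4) (z : Fin 4 → ℤ),
      hessKer (AF 1) (𝒱F 1) (𝒲F 1) μ ν z
        = (Lc : ℝ) ^ 8 * dressedEntry (wStep Lc 1) (TshotOf Lc (JcComp hLc N cΛ cB (Roots.ctr Lc) Pn) 1) ((Lc : ℤ) • z) μ ν)
    (htr : ∀ j : ℕ, 1 ≤ j → ∀ (μ ν : Fin 4) (z : Fin 4 → ℤ),
      hessKer (AF (j + 1)) (𝒱F (j + 1)) (𝒲F (j + 1)) μ ν z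
        = (Lc : ℝ) ^ 8 * dressedEntry (wStep Lc (j + 1))
            (hessKer (AN (Roots.ctr Lc) j) (VN (Roots.ctr Lc) Pn j) (WN (Roots.ctr Lc) Pn j)) ((Lc : ℤ) • z) μ ν)
    (hG : ∀ j : ℕ, 1 ≤ j → ∀ (μ ν : Fin 4) (z : Fin 4 → ℤ),
      hessKer (GcombSh (d := 3) Lc j) (𝒱G j) (𝒲G j) μ ν z = TbalOf Lc (JsB12CombShSym hLc N (symTablesAn1S2 3 Lc cΛ) cΛ cB) j μ ν z)
    (hT0 : ∀ j (c e : Fin 4), HasSum (TbalOf Lc (JsB12CombShSym hLc N (symTablesAn1S2 3 Lc cΛ) cΛ cB) j c e) 0)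
    (hT1 : ∀ j (c e ρ : Fin 4), HasSum (fun t : Fin 4 → ℤ => t ρ • TbalOf Lc (JsB12CombShSym hLc N (symTablesAn1S2 3 Lc cΛ) cΛ cB) j c e t) 0) :
    D1Tel Lc (JsB12CombShSym hLc N (symTablesAn1S2 3 Lc cΛ) cΛ cB) (JcComp hLc N cΛ cB (Roots.ctr Lc) Pn) := by
  have hL0 : 0 < Lc := Nat.pos_of_ne_zero (NeZero.ne Lc)
  have hL1 : 1 ≤ Lc := hL0
  refine d1Tel_JcComp_ctr_nested_of_hessKer_laws_wStep hLc N cΛ cB Pn AF 𝒱F 𝒲F (fun j => GcombSh (d := 3) Lc j) 𝒱G 𝒲G ?_ hF₁ htr hG hT0 hT1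
  intro j hj μ ν z
  obtain ⟨n, rfl⟩ : ∃ n, j = n + 1 := ⟨j - 1, by omega⟩
  obtain ⟨δA, CA, hδA, -, hA⟩ := decays_compChart (d := 3) hL1 (rc := (Roots.ctr Lc).rc) (fun _ => ctrOff_mem_box (d := 3 + 1) hL1) (n + 1 + 1)
    (s := (Roots.ctr Lc).s (n + 1 + 1)) (ctrOff_mem_box (d := 3 + 1) (Nat.one_le_pow _ _ hL1))
  exact hessKer_law_tower_named (Lc := Lc) (M' := fun B => fine Lc (Mc B)) (lev := fun i : ℕ => n + 1 - i) (n := n)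
      (hM'gr := (fun K => (hMc K).mono fun B hB i => le_trans (hB i) (Nat.le_mul_of_pos_left _ hL0)))
      (hlev := (fun i hi => by show n + 1 - i = n + 1 - (i + 1) + 1; omega)) (𝒱N := (VN (Roots.ctr Lc) Pn (n + 1))) (𝒱F := (𝒱F (n + 1)))
      (𝒱G := (𝒱G (n + 1))) (𝒲N := (WN (Roots.ctr Lc) Pn (n + 1))) (𝒲F := (𝒲F (n + 1))) (𝒲G := (𝒲G (n + 1))) (μ := μ) (ν := ν) (z := z)
      (hM' := (fun B i => ⟨Mc B i, rfl⟩)) (κ := (fun B => ↥(pbox (Mc B)) × Fin (3 + 1))) (pμ' := (fun B a => coarsePt (Mc B) Lc a.1))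
      (mμ' := (fun B a => a.2)) (hfμ' := (fun B => coarseSlot_injective (Mc B))) (hcoarse' := (fun B => coarseSlot_range (Mc B))) (H₀ := H₀ n)
      (Q₁₀ := Q₁₀ n) (τ₁ := τ₁ n) (hH₀ := hH₀ n) (hQ₁₀ := hQ₁₀ n) (hτ₁ := hτ₁ n) (τ₂ := τ₂ n) (hτ₂ := hτ₂ n) (Q₂₀ := Q₂₀ n) (hQ₂₀ := hQ₂₀ n) (W₀ := W₀ n)
      (hW₀ := hW₀ n) (P := P n) (hP := hP n) (c := c n) (Dbar := Dbar n) (hDbar := hDbar n) (Γ := Γ n) (I := I n) (L := L n) (S := S n) (hΓ := hΓ n)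
      (hI := hI n) (hL := hL n) (hS := hS n) (𝔔₀ := 𝔔₀ n) (h𝔔₀ := h𝔔₀ n) (hv := hv n) (hhv := hhv n) (lv := lv n) (hlv := hlv n) (Xbf := Xbf n)
      (hXbf := hXbf n) (H₁f := H₁f n) (hH₁l := fun B => H1f_linear Lc N (n + 1) (fine Lc (Mc B)) (fun i : ℕ => n + 1 - i) ((cf n) B) (w n) (c n) ((hb n) B) ((hbl n) B) ((H₁f n) B) ((hH₁f n) B)) (Q₁₁f := Q₁₁f n) (hQ₁₁f := hQ₁₁f n) (Q₂₁f := Q₂₁f n) (hQ₂₁f := hQ₂₁f n) (H₂f := H₂f n)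
      (hH₂l := hH₂l n) (hH₂r := hH₂r n) (Q₁₂f := Q₁₂f n) (hQ₁₂f := hQ₁₂f n) (Q₂₂f := Q₂₂f n) (hQ₂₂f := hQ₂₂f n) (𝔔₁f := 𝔔₁f n) (h𝔔₁ := h𝔔₁ n) (𝔔₂f := 𝔔₂f n)
      (h𝔔₂ := h𝔔₂ n) (H'₁f := H'₁f n) (hH'₁f := hH'₁f n) (H'₂f := H'₂f n) (hH'₂f := hH'₂f n) (𝔔'₁f := 𝔔'₁f n) (h𝔔'₁f := h𝔔'₁f n) (𝔔'₂f := 𝔔'₂f n)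
      (h𝔔'₂f := h𝔔'₂f n) (W₁f := W₁f n) (W₂f := W₂f n) (hW₁f := hW₁f n) (hW₂f := hW₂f n) (Db₁f := Db₁f n) (Db₂f := Db₂f n) (hDb₁f := hDb₁f n)
      (hDb₂f := hDb₂f n) (Y₁f := fun B _ => 0) (Y₂f := Y₂f n) (Gw₁f := Gw₁f n) (hGw₁f := hGw₁f n) (Gw₂f := Gw₂f n) (hGw₂f := hGw₂f n) (hH₁t := fun B v => H1f_transpose Lc N (n + 1) (fine Lc (Mc B)) (fun i : ℕ => n + 1 - i) ((cf n) B) (w n) (c n) ((hb n) B) ((H₁f n) B) ((hH₁f n) B) v)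
      (hH₂t := hH₂t n) (a1 := fun B v => a1_row Lc N hLc2 (ctrOff_mem_box (d := 3 + 1) hL1) (n + 1) (fine Lc (Mc B)) (fun i : ℕ => n + 1 - i) ((Ma n) B) ((hMa n) B) ((cf n) B) ((hcf n) B) (w n) (κ n) ((hκ n)) ((hκn n)) ((hb n) B) ρH (c n) ((K1 n) B) ((hlink n) B) (n + 1 - (n + 1)) (Nat.sub_self _) ((hH₀ n) B) ((hW₀ n) B) ((W₁f n) B) (fun v => by rw [(hW₁f n) B v, ← (hbtop n) B v]) ((H₁f n) B) ((hH₁f n) B) ((𝔔₀ n) B) v) (a2 := a2 n) (σ := (Fin 2)) (dv := (fun B => ![(dv n) B (μ, 0), (dv n) B (ν, z)])) (a₁ := 0) (a₂ := 1) (XN := XN n)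
      (hXN := hXN n) (ρN := ρN n) (LNc := LNc n) (fN := fN n) (hfN := hfN n) (hmN := hmN n) (hcN := hcN n) (AN := (AN (Roots.ctr Lc) (n + 1))) (hAN := hA)
      (hαN := hδA)
      (hANsh := (fun t => by rw [show (((Lc ^ (n + 2) : ℕ) : ℤ) • t) = -((((Lc ^ (n + 1 + 1) : ℕ) : ℤ)) • (-t)) by rw [smul_neg, neg_neg]]; exact shiftK_compChart (d := 3) hL1 (rc := (Roots.ctr Lc).rc) (n + 1 + 1) (s := (Roots.ctr Lc).s (n + 1 + 1)) (-t)))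
      (hEAN := hEAN n) (hAEN := hAEN n) (hLN := hLN n) (pN := ((((NN n : ℕ) : ℤ)) • (0 : Fin (3 + 1) → ℤ)))
      (pN' := ((((NN n : ℕ) : ℤ)) • (0 : Fin (3 + 1) → ℤ))) (qN := ((((NN n : ℕ) : ℤ)) • z)) (qN' := ((((NN n : ℕ) : ℤ)) • z)) (CvN := (CvN n))
      (CvN' := (CvN n)) (CwN := (CwN n)) (δN := (δN n)) (hVN := (hVN n μ 0)) (hVN' := (hVN n ν z)) (hWN := (hWN n μ 0 ν z)) (hδN := (hδN n))
      (hVNm := (hVNm n μ 0)) (hVNt := (hVNt n μ 0)) (hVN'm := (hVNm n ν z)) (hVN't := (hVNt n ν z)) (hWNm := (hWNm n μ 0 ν z)) (hWNt := (hWNt n μ 0 ν z))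
      (hHN₁ := (hHN₁ n μ 0)) (hQN₁ := (hQN₁ n μ 0)) (hHN₁' := (hHN₁ n ν z)) (hQN₁' := (hQN₁ n ν z)) (hHN₂ := (hHN₂ n μ 0 ν z)) (hQN₂ := (hQN₂ n μ 0 ν z))
      (XF := XF n) (hXF := hXF n) (ρF := ρF n) (LFc := LFc n) (fF := fF n) (hfF := hfF n) (hmF := hmF n) (hcF := hcF n) (AF := (AF (n + 1))) (CAF := CAF n)
      (αF := αF n) (hAF := hAF n) (hαF := hαF n) (hAFsh := hAFsh n) (hEAF := hEAF n) (hAEF := hAEF n) (hLF := hLF n)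
      (pF := ((((NF n : ℕ) : ℤ)) • (0 : Fin (3 + 1) → ℤ))) (pF' := ((((NF n : ℕ) : ℤ)) • (0 : Fin (3 + 1) → ℤ))) (qF := ((((NF n : ℕ) : ℤ)) • z))
      (qF' := ((((NF n : ℕ) : ℤ)) • z)) (CvF := (CvF n)) (CvF' := (CvF n)) (CwF := (CwF n)) (δF := (δF n)) (hVF := (hVF n μ 0)) (hVF' := (hVF n ν z))
      (hWF := (hWF n μ 0 ν z)) (hδF := (hδF n)) (hVFm := (hVFm n μ 0)) (hVFt := (hVFt n μ 0)) (hVF'm := (hVFm n ν z)) (hVF't := (hVFt n ν z))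
      (hWFm := (hWFm n μ 0 ν z)) (hWFt := (hWFt n μ 0 ν z)) (hHF₁ := (hHF₁ n μ 0)) (hQF₁ := (hQF₁ n μ 0)) (hHF₁' := (hHF₁ n ν z)) (hQF₁' := (hQF₁ n ν z))
      (hHF₂ := (hHF₂ n μ 0 ν z)) (hQF₂ := (hQF₂ n μ 0 ν z)) (pG := ((((NG n : ℕ) : ℤ)) • (0 : Fin (3 + 1) → ℤ)))
      (pG' := ((((NG n : ℕ) : ℤ)) • (0 : Fin (3 + 1) → ℤ))) (qG := ((((NG n : ℕ) : ℤ)) • z)) (qG' := ((((NG n : ℕ) : ℤ)) • z)) (CvG := (CvG n))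
      (CvG' := (CvG n)) (CwG := (CwG n)) (δG := (δG n)) (hVG := (hVG n μ 0)) (hVG' := (hVG n ν z)) (hWG := (hWG n μ 0 ν z)) (hδG := (hδG n))
      (hVGm := (hVGm n μ 0)) (hVGt := (hVGt n μ 0)) (hVG'm := (hVGm n ν z)) (hVG't := (hVGt n ν z)) (hWGm := (hWGm n μ 0 ν z)) (hWGt := (hWGt n μ 0 ν z))
      (hHG₁ := (hHG₁ n μ 0)) (hQG₁ := (hQG₁ n μ 0)) (hHG₁' := (hHG₁ n ν z)) (hQG₁' := (hQG₁ n ν z)) (hHG₂ := (hHG₂ n μ 0 ν z)) (hQG₂ := (hQG₂ n μ 0 ν z))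

end Summit.QuantumFields.BalabanUV.Beta.FP.StepRecursionFeedNestedNamedB

end
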